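import Summits.QuantumFields.YangMills.Theorems.BalabanUVNodesK2V7Defs
import Summits.QuantumFields.YangMills.Theorems.BalabanUVNodesK2RunRowsContOfCorner
import Summits.QuantumFields.YangMills.Theorems.BalabanUVNodesK1R8RowsDefs

/-!
# IDEA-1 g13 — APPROXIMANT-LAPLACE SQUEEZE for K2⁷ `EndpointGivenBR13SepCoPH` (stmt-QuantumFields-20543, `aside` since rev 27) read on the DECIDING crux K1⁸ `StabilityBRunRowsAtRecordR13SepCoPH` (stmt-QuantumFields-26907) — SKETCH EDITION 4

Crux idea sketch (planner seat `ym-nodeO-idea-1`, gen 13; edition 4 supersedes editions 1 (gen 11), 2, 3∕3b (gen 12) of this file; §1–§5 and the texts A ∕ (VC) ∕ (UD) ∕ C are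
UNCHANGED IN CONTENT — edition 4 ADDS the (1.21) existence clause by name (§5, V-1), the finite-volume continuity letter (§6b, IDEA-4 g13 n2) and the K1⁸ bearing BY NAME (§7)).  HONEST FRAMING: nothing of Bałaban's analysis is
proved here; every analytic input is a HYPOTHESIS SHAPE (`def … : Prop`, an OBLIGATION TEXT, never a fact); the kernel content is real-number ∕ `tsum`
bookkeeping + by-name composition; K2⁷ is OPEN; [I] Thm 2 ∕ (0.31) p.259 (NODE O) is UNPROVED IN PRINT; route R4 closes only the conditional finite-𝕋⁴ rung
`BalabanLadder.UV`; no continuum ∕ OS ∕ mass-gap claim — the Yang–Mills mass gap (Clay) is NOT proved.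

THE LEVER (unchanged).  The β-function of record at scale `k` is (1.22) of the `K′ → ∞` LIMIT (`Node00.polLimit` = `limUnder atTop`) of the windowed kernels of
the merged step functional of the `K′`-th approximation, which lives on a torus with `2L^{m+K′−k−1}` sites per direction.  At DEPTH `r := K′−k−1` the one-step
fluctuation integral (2.13) is a FINITE-dimensional Laplace integral whose dimension depends on `r` ONLY, not on `k`.  WHERE THE HISTORY ENTERS (F-E, located in
ed.3): on the tree object the `(k+1)`-th step integrand is `χ_k · exp(−GF_k/g_k² + A_k)` (`B12Eq019ActionBody.integrand` ∕ `nextAction`, iterated by `printedSeq` from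
`wilsonTerm (g 0)`; `Node00.BackgroundActionT.effActionHT_succ`; the window `chiFixed29` is coupling-blind by `rfl`): the LAST entry `g_k` is the gauge-fixing strength of
the last step and nothing else, the Wilson coupling is `g_0`, the entries `g_1, …, g_{k−1}` are the earlier gauge-fixing strengths, and the main-term coupling of `A_k` is
whatever the literal recursion produced from them (print's running `g_k` ALONG (0.18)-RUNS, by the Thm-1 format the crux is GIVEN as `EndStatementBPrinted`).  Hence the
semiclassical parameter of a free history is its SIZE `‖v‖ = max_j g_j`, and HYP A is typed in that currency: a CRUDE, dimension-dependent log-moment bound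
(`LogMomentBound`, §3) is to give `β^{(r)}_{k+1}(v) = b⁰^{(r)}_k + O(C(r)·‖v‖²)` (HYP A, `FinLaplace`); a k-UNIFORM thermodynamic rate `|β^{(r)} − β| ≤ τ(r) → 0` on the
box (HYP B, `ThermoRate`) transfers it to the record; DEPTH IS TRADED AGAINST THE BOX (`|β − b∞| ≤ 2τ(r) + C(r)γ²` on `]0, γ]^{k+1}` — every consumer needs only the
box size): per-scale ANCHOR at the limiting one-loop numbers and a `ConstRemainder` at EVERY cap; with v7c's REGISTERED 2ᶜᴰ `CornerDriftPos` (`stub_cornerDriftPos13`,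
skeleton sha 795c9e8285fed415) and (C) `SurvCont`, the crux decl BY NAME.

CHANGES IN EDITION 4 (g13, 2026-08-28; answers CRIT-1 g5 riders V-1∕V-2 (`CRIT-1-LOCATED-A-VALUE-approximant-laplace-idea1-g12.md`), IDEA-4 g13 nit n2
(`REV27-K1R8-ROWMAP-idea4-g13.md` ed.2 §3 + kernel `Idea4g13ContFromThermoRate.lean` 7d951acc159d), and route rev 27 12afebc05bbc (K2⁷ → `aside`; DECIDING crux K1⁸ stmt-QuantumFields-26907
with rows conjunct `K1R8RowsDefs.RunRowsCont13 F θ`; K2⁸ 26908 born-closed)).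
* V-1 — THE (1.21) EXISTENCE CLAUSE DISPLAYED (§5 `PolLimit13` ∕ `PolLimitOnBox13` = `Node00.PolLimitExists` of the record's family BY NAME): `limKernel13 := Node00.polLimit …` is a
  `limUnder` — the printed limit WHEN IT EXISTS and junk otherwise — so TEXT B-i (VC) and TEXT B-ii (UD), which speak about `limKernel13`, now CARRY `PolLimitOnBox13 F θ γ̄` as a
  displayed conjunct (an estimate of print, [I] p.264 «This limit exists by the localized representation (1.7)», never asserted here).  Kernel: under `PolLimit13`, the depth-`r`
  windowed kernels `finKernel13 F θ r k v` CONVERGE to `limKernel13 F θ k v` entrywise (`tendsto_finKernel13_of_polLimit13`, index shift `K = k+1+r`) and so do the radius-`R` truncated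
  moments at every FIXED `R` (`tendsto_truncMoment_finKernel13_of_polLimit13`) — which displays exactly what (VC) adds to existence: a k-UNIFORM RATE along the DIAGONAL `R = r`.
* V-2 — DEBT-TABLE WORDING (card ed.5): the K-texts A ∕ B-i ∕ B-ii ∕ FC are stated UNDER K2⁷'s OWN GUARDS (unity ∧ slots → admissible → (B) → `Window13`), i.e. on exactly the tuples
  the crux quantifies over — no new ∀θ surface beyond the crux's; and for K1⁸ (∃-side) only the per-tuple atoms AT THE WITNESS are consumed (§7 `runRowsCont13_of_cornerDriftAt_pkgAt_survContAt`,
  `stabilityBRunRowsAtRecordR13SepCoPH_of_witnessAtoms`).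
* n2 (IDEA-4 g13) ADOPTED — TEXT C SHRINKS ON THIS LINE: (VC) + (UD) already give `ThermoRate13` with a NULL rate (`thermoRate13_of_volConv_unifDecay`, `tendsto_rate_of_volConv_unifDecay`);
  a uniform limit of eventually-continuous functions is continuous; hence (C) on the boxes and run-wise (C) follow from the ONE finite-volume letter `FinContEv (betaFin F θ) γ̄`
  («the depth-`r` truncated finite-volume β is continuous on the box for all large `r`» — finitely many finite-dimensional integrals per `(r, k)`).  §6b re-derives IDEA-4's
  moment-currency twin (`betaContH_of_thermoRate_finContEv`, VERBATIM proof, attributed; restated only because crux workfiles are not importable) and proves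
  `survCont13K_of_volConv_unifDecay_finCont : VolConv13K → UnifDecay13K → FinCont13K → SurvCont13K`; the displayed line becomes
  `CornerDriftPos → FinLaplace13K → VolConv13K → UnifDecay13K → FinCont13K → crux` (`EndpointGivenBR13SepCoPH_of_line4`).  PRIOR ART (a variant, claimed as nothing more): the SITEWISE
  road `Literature/…/Beta/BetaContinuityVolume` (`continuousOn_of_uniform_rate`, `betaContH_of_chain_volumeRate`) and `Theorems/BalabanUVNodesN26BetaContRecord` §4∕§5.
* §7 — K1⁸ BEARING BY NAME (rev 27): at ONE tuple, 2ᶜᴰ's body + the package + (C) at small levels ⟹ the rows conjunct `RunRowsCont13 F θ` with floor `M := 2A` paid by the drift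
  (an4 g153∕p616839 `K2RunRowsContOfCorner.runRowsCont13Body_of_drift_runConstRemainder_survCont` BY NAME); K-keyed, {2ᶜᴰ, 1ᴬᴸ} ⟹ an4's weak K-text ⟹ the ∀θ programme
  `K1R8RowsDefs.RowsContAll` (`rowsContAllK_of_ownDrift_runConstRemainderK`), hence WITH K1⁷ the deciding crux decl `…Theses.BalabanUVNodes.StabilityBRunRowsAtRecordR13SepCoPH` BY NAME
  (DEF-1 g7∕p616926 `stabilityBRunRowsAtRecordR13SepCoPH_of_k17_rowsContAll`) — `stabilityBRunRowsAtRecordR13SepCoPH_of_k17_line4`; and the honest ∃-side form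
  `stabilityBRunRowsAtRecordR13SepCoPH_of_witnessAtoms` (the three atoms at K1⁷'s witness only).  This kernel-checks g12's claim «package + `OneLoopDrift` ⇒ row (iv), M = 2A».
* F-E′ (print currency of the last entry) is CLOSED FOR THIS LINE by CRIT-2 g3 S.1957 (`CRIT-2-ADDENDUM2-FE-last-entry-currency.md`, kernel `Crit2LastEntryBlind.lean` a618bff64760):
  on runs print (0.22) p.256 and the tree agree; off-run the tree's `betaOfRecord₁₃` ≠ print's β_{k+1}; every text of this file is in RUN or BOX-SIZE currency, hence F-E′-safe; cited, not redone.
* D1-side new-lever pass (items lens, row D1): the candidate «composed-determinant drift» (cumulative one-loop coefficient of the COMPOSED k-step Gaussian = s·k + O(1), no per-step limit)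
  REDUCES to pub-balaban `BETA/AN1.md` §7 (T-drift) + repair census C2∕C3 (an1, 2026-08-18; kernel `Beta/Drift.lean`) and BINDER row D1 (an2) — in cone, NOT filed (honest null).
CHANGES IN EDITION 3 (g12, later the same day) — F-E LOCATED, BOX-SIZE CURRENCY.  (Ed.3b: import switched to DEF-1's `Theorems/BalabanUVNodesK2V7Defs` (p613755);
`cornerDriftPos_iff_tree : CornerDriftPos ↔ K2V7Defs.CornerDriftPos := Iff.rfl` and `EndpointGivenBR13SepCoPH_of_line_treeNamed` feed 2ᶜᴰ under its TREE NAME.)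
* The desk falsifier F-E of the card («is the step even in `g_k` ∕ where does the history enter?») was run ON THE TREE's encoding and LOCATED (files above): the last
  entry of a free history is only the gauge-fixing prefactor of the last step.  Consequences drawn here: (i) HYP A `FinLaplace` and the collapse certificate's
  `ParabolicModulus` are RE-TYPED with `‖v‖²` (sup norm of the history = box size; `pi_norm_const`, `pi_norm_le_iff_of_nonneg`) in place of `g_k²` — strictly WEAKER
  hypotheses, IDENTICAL outputs (`squeeze_at_bInf`, `scaleAnchor_bInf`, `constRemainder_bInf`, §2, §2b, §6 untouched: they only ever used the box size); (ii) the
  ed.1∕2 bonus `tendsto_last_bInf` (a limit in `g_k` alone at a fixed base history) is WITHDRAWN as a statement about the gauge-fixing strength, not about the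
  semiclassical parameter (CRIT-2 g3's «corner, not base line», now with a structural reason); (iii) the card's «evenness in `g_k`» is demoted: trivially true of the
  last entry on the tree object, and not the source of the `O(·²)` — which is the Laplace expansion in the main-term coupling, of box size.  Flag for the cell (card
  ed.4): every BOX-WISE text in LAST-ENTRY currency over FREE histories (`BoxRemainder`, a `LastEntryModulus`, `OneLoopSplit.vanish`-type faces at `g_k = 0`, where
  `−(1/0²)·GF = 0` removes the gauge fixing) quantifies over off-run gauge-fixing strengths that print never controls; RUN-WISE ∕ WINDOW-LEVEL currencies
  (`runConstRemainder_of_windowBound`, `…_of_omegaModulus`, `RunConstRemainder`, `ScaleAnchor`, `ConstRemainder`) are the dischargeable ones.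
CHANGES IN EDITION 2 (g12).
* A3 SELF-CORRECTION (vacuity audit, junk value).  Ed.1 pinned `betaFin` as `B12Beta.secondMoment` (a `tsum` over ALL of `ℤ⁴`) of the finite-volume WINDOWED kernel
  `Node00.polWindow …`, which is PERIODIC in `z` (`siteOfInt` casts to `ZMod`), so `z ↦ Π(z) z_μ z_ν` is not summable unless zero and the `tsum` is the junk value `0`:
  ed.1's pinned `FinLaplace13` was trivially satisfiable and its `ThermoRate13` said `β ≡ 0` up to `τ`.  Ed.2: `betaFin F θ r k hist := truncMoment r (finKernel13 F θ r k hist) 0 1`,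
  the radius-`r` TRUNCATED second moment (a finite sum, §4–§5).  The abstract layer (§1) was never affected.
* `Antitone τ` DROPPED from the package (Cauchy from `τ → 0` alone, `cauchySeq_of_dist_le_null`).
* COLLAPSE CERTIFICATE (§1b, `approxLaplacePkg_iff_parabolic`): the abstract package `∃ βf b0f C τ γ̄, …` is EQUIVALENT to a parabolic box modulus
  `|β k v − b k| ≤ τ r + C r·‖v‖²` (ed.3 currency) for some history-free family `b` — i.e. the ∃-layer is (5d)-class plumbing (an4's `cornerRunConstRemainderK` socket); the CONTENT
  of the idea is carried ONLY by the PINNED texts over `betaFin` ∕ `finKernel13` ∕ `limKernel13` (§5–§6).  Stated so that no reader mistakes the package for the lever.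
* HYP B SPLIT INTO CELL CURRENCIES (§4, kernel-checked): (VC) k-uniform VOLUME CONVERGENCE of truncated moments on the window (`VolConv`, NEW, g²-free, locality
  class) + (UD) UNIFORM (5.10)-DECAY of the limiting kernels on the box (`UnifDecay` = N17's `hU` shape, EXISTING currency) ⟹ `ThermoRate` with
  `τ r = τ₁ r + C·Σ_{z ∉ [−r,r]⁴} |z|₁² e^{−δ₁|z|₁}` (`thermoRate_of_volConv_unifDecay`, `tendsto_tailMajorant`).
* KEYED TO THE TREE's NEW SOCKET: an4 g153 p613430 `BalabanUVNodesK2RunRowsSandwich.EndpointGivenBR13SepCoPH_of_cornerDriftK_cornerRunConstRemainderK` — §2b derives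
  its `h₂` from `ApproxLaplace13` and §6 composes the FIVE displayed texts to the crux decl through it (`EndpointGivenBR13SepCoPH_of_line`).
* THE RECORD's β IS (1.22) OF `limKernel13` on the design box (`βfun_eq_secondMoment_limKernel13`, def-T ∕ def-B `rfl` faces + `betaOfMerged_of_mem`).
An ideator registers nothing: §6 is «what a line would look like», displayed for CRIT-1 and the plan seat.
-/


noncomputable section

namespace Summit.QuantumFields.YangMills.Cruxes.EndpointGivenBR13SepCoPH.ApproximantLaplace

open Filter Topology MeasureTheory
open scoped Matrix.Norms.L2Operator
open Literature.MathematicalPhysics.QuantumFieldTheory.Balaban1983to89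
open Literature.MathematicalPhysics.QuantumFieldTheory.Balaban1983to89.FlowStep
open Literature.MathematicalPhysics.QuantumFieldTheory.Balaban1983to89.B12Beta (HistBox)
open Literature.MathematicalPhysics.QuantumFieldTheory.Balaban1983to89.DagBinding (EndpointExistence)
open Literature.MathematicalPhysics.QuantumFieldTheory.Balaban1983to89.T4Continuum (T4Family)
open Literature.MathematicalPhysics.QuantumFieldTheory.Balaban1983to89.Beta.Drift (OneLoopDrift)
open Summit.QuantumFields.YangMills.Theorems.BalabanUVNodesK2NamedJetsRemAt (ConstRemainder ScaleAnchor)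
open Summit.QuantumFields.YangMills.Theorems.BalabanUVNodesK2NamedJetsRunRemAt
  (RunConstRemainder SurvCont runConstRemainder_of_constRemainder endpointExistence_of_drift_runConstRemainder_survCont)
open Summit.QuantumFields.YangMills.Theorems.BalabanUVNodesK2V6Defs (Window13)

/-! ## §1 Abstract real analysis: finite-volume Laplace pieces + thermodynamic rate ⟹ anchor + squeeze + constant remainder -/

section Abstract

variable {β : HBeta} {βf : ℕ → HBeta} {b0f : ℕ → ℕ → ℝ} {C τ : ℕ → ℝ} {γbar : ℝ}

/-- HYP A shape — **FINITE-VOLUME LAPLACE at depth `r`, BOX-SIZE CURRENCY (ed.3)**: on the box `]0, γ̄]^{k+1}` the depth-`r` finite-volume β differs from a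
HISTORY-FREE number `b0f r k` (the finite-volume one-loop number) by `C r · ‖v‖²`, `‖v‖ = max_j g_j` the SUP of the history (NOT `g_k²`, the last entry: on the
tree object `hist (Fin.last k)` enters the `(k+1)`-th step only as the gauge-fixing prefactor `exp(−GF/g_k²)` of `B12Eq019ActionBody.integrand`, the Wilson coupling
only as `g_0` — F-E of the card; the semiclassical parameter of an off-run history is its size, and every consumer below needs only the box size).
[cite: Balaban1987RG1, (2.12)–(2.14) p.268 and (1.3) p.260] -/
def FinLaplace (βf : ℕ → HBeta) (b0f : ℕ → ℕ → ℝ) (C : ℕ → ℝ) (γbar : ℝ) : Prop :=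
  ∀ (r k : ℕ) (v : Fin (k + 1) → ℝ), v ∈ HistBox γbar k → |βf r k v - b0f r k| ≤ C r * ‖v‖ ^ 2

/-- HYP B shape — **k-UNIFORM THERMODYNAMIC RATE**: the depth-`r` finite-volume β is within `τ r` of the record's β on the box, for every scale `k`.
[cite: Balaban1987RG1, (1.21) p.264 and (1.18)–(1.19) p.263] -/
def ThermoRate (β : HBeta) (βf : ℕ → HBeta) (τ : ℕ → ℝ) (γbar : ℝ) : Prop :=
  ∀ (r k : ℕ) (v : Fin (k + 1) → ℝ), v ∈ HistBox γbar k → |βf r k v - β k v| ≤ τ r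

/-- Elementary: a bound `X ≤ Y + D·g²` for all `g ∈ ]0, γ̄]` forces `X ≤ Y`. [folklore] -/
theorem le_of_forall_sq {X Y D γbar : ℝ} (hγ : 0 < γbar) (hD : 0 ≤ D)
    (h : ∀ g : ℝ, 0 < g → g ≤ γbar → X ≤ Y + D * g ^ 2) : X ≤ Y := by
  by_contra hlt
  push Not at hlt
  set ε := X - Y with hε
  have hεpos : 0 < ε := by linarith
  set g := min γbar (ε / (2 * (D + 1) * γbar)) with hg
  have hD1 : 0 < D + 1 := by linarith
  have hgpos : 0 < g := lt_min hγ (by positivity)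
  have hgle : g ≤ γbar := min_le_left _ _
  have hgle' : g ≤ ε / (2 * (D + 1) * γbar) := min_le_right _ _
  have h1 := h g hgpos hgle
  have hsq : D * g ^ 2 ≤ D * (γbar * g) := by
    apply mul_le_mul_of_nonneg_left _ hD
    nlinarith
  have h2 : D * (γbar * g) ≤ D * (γbar * (ε / (2 * (D + 1) * γbar))) := by
    apply mul_le_mul_of_nonneg_left _ hD
    exact mul_le_mul_of_nonneg_left hgle' hγ.le
  have h3 : D * (γbar * (ε / (2 * (D + 1) * γbar))) = ε / 2 * (D / (D + 1)) := by
    field_simp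
  have h4 : D / (D + 1) ≤ 1 := by
    rw [div_le_one hD1]; linarith
  have h5 : ε / 2 * (D / (D + 1)) ≤ ε / 2 := by
    have := mul_le_mul_of_nonneg_left h4 (by positivity : (0:ℝ) ≤ ε / 2)
    simpa using this
  linarith

variable (hγ : 0 < γbar) (hC : ∀ r, 0 ≤ C r) (hA : FinLaplace βf b0f C γbar) (hB : ThermoRate β βf τ γbar)
include hγ hC hA hB

/-- The finite-volume one-loop numbers are `τ`-close across depths: `|b0f r k − b0f r' k| ≤ τ r + τ r'`. [folklore] -/
theorem b0f_dist_le (k r r' : ℕ) : |b0f r k - b0f r' k| ≤ τ r + τ r' := by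
  refine le_of_forall_sq hγ (add_nonneg (hC r) (hC r')) fun g hg hgle => ?_
  set v : Fin (k + 1) → ℝ := fun _ => g with hv
  have hvmem : v ∈ HistBox γbar k := fun _ => ⟨hg, hgle⟩
  have e1 := hA r k v hvmem
  have e2 := hB r k v hvmem
  have e3 := hB r' k v hvmem
  have e4 := hA r' k v hvmem
  have hnorm : ‖v‖ = g := by rw [hv, pi_norm_const, Real.norm_eq_abs, abs_of_pos hg]
  rw [hnorm] at e1 e4
  have key : |b0f r k - b0f r' k| ≤ |βf r k v - b0f r k| + |βf r k v - β k v| + |βf r' k v - β k v| + |βf r' k v - b0f r' k| := by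
    have := abs_sub_le (b0f r k) (βf r k v) (b0f r' k)
    have := abs_sub_le (βf r k v) (β k v) (b0f r' k)
    have := abs_sub_le (β k v) (βf r' k v) (b0f r' k)
    rw [abs_sub_comm (b0f r k) (βf r k v)] at *
    rw [abs_sub_comm (β k v) (βf r' k v)] at *
    linarith
  nlinarith

omit hγ hC hA hB in
/-- Cauchy criterion with a NULL modulus (no monotonicity asked — ed.2 drops ed.1's `Antitone τ`). [folklore] -/
theorem cauchySeq_of_dist_le_null {u : ℕ → ℝ} {τ : ℕ → ℝ} (hτ0 : Tendsto τ atTop (𝓝 0))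
    (h : ∀ r r', |u r - u r'| ≤ τ r + τ r') : CauchySeq u := by
  refine Metric.cauchySeq_iff'.2 fun ε hε => ?_
  have hev : ∀ᶠ r in atTop, τ r < ε / 2 := (tendsto_order.1 hτ0).2 _ (by positivity)
  obtain ⟨N, hN⟩ := eventually_atTop.1 hev
  refine ⟨N, fun n hn => ?_⟩
  rw [Real.dist_eq]
  have := h n N
  linarith [hN n hn, hN N le_rfl]

variable (hτ0 : Tendsto τ atTop (𝓝 0))
include hτ0

/-- **THE LIMITING ONE-LOOP NUMBERS EXIST**: `b0f r k → b∞ k` as the depth `r → ∞`, with the rate `|b0f r k − b∞ k| ≤ τ r`. [folklore] -/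
theorem exists_bInf : ∃ bInf : ℕ → ℝ, ∀ k, Tendsto (fun r => b0f r k) atTop (𝓝 (bInf k)) ∧ ∀ r, |b0f r k - bInf k| ≤ τ r := by
  have hk : ∀ k, ∃ L : ℝ, Tendsto (fun r => b0f r k) atTop (𝓝 L) ∧ ∀ r, |b0f r k - L| ≤ τ r := by
    intro k
    obtain ⟨L, hL⟩ := cauchySeq_tendsto_of_complete
      (cauchySeq_of_dist_le_null hτ0 (fun r r' => b0f_dist_le hγ hC hA hB k r r'))
    refine ⟨L, hL, fun r => ?_⟩
    have h1 : Tendsto (fun r' => |b0f r k - b0f r' k|) atTop (𝓝 |b0f r k - L|) :=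
      ((tendsto_const_nhds.sub hL).abs)
    have h2 : Tendsto (fun r' => τ r + τ r') atTop (𝓝 (τ r + 0)) := tendsto_const_nhds.add hτ0
    have := le_of_tendsto_of_tendsto' h1 h2 (fun r' => b0f_dist_le hγ hC hA hB k r r')
    simpa using this
  choose bInf hb using hk
  exact ⟨bInf, hb⟩

omit hγ hC hτ0 in
/-- The SUP-NORM squeeze on the big box: `|β_{k+1}(v) − b∞_k| ≤ 2·τ r + C r·‖v‖²` for every depth `r`. [folklore] -/
theorem squeeze_norm {bInf : ℕ → ℝ} (hb : ∀ k r, |b0f r k - bInf k| ≤ τ r)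
    (r k : ℕ) (v : Fin (k + 1) → ℝ) (hv : v ∈ HistBox γbar k) :
    |β k v - bInf k| ≤ 2 * τ r + C r * ‖v‖ ^ 2 := by
  have e1 := hA r k v hv
  have e2 := hB r k v hv
  have e3 := hb k r
  have t1 := abs_sub_le (β k v) (βf r k v) (bInf k)
  have t2 := abs_sub_le (βf r k v) (b0f r k) (bInf k)
  rw [abs_sub_comm (β k v) (βf r k v)] at t1
  linarith

omit hγ hτ0 in
/-- **THE TWO-PARAMETER SQUEEZE at the limiting numbers**: on `]0, γ]^{k+1}` with `γ ≤ γ̄`, `|β_{k+1}(v) − b∞_k| ≤ 2·τ r + C r·γ²` for EVERY depth `r`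
(depth first, box after — the quantifier order that makes a dimension-dependent Laplace constant harmless). [folklore] -/
theorem squeeze_at_bInf {bInf : ℕ → ℝ} (hb : ∀ k r, |b0f r k - bInf k| ≤ τ r)
    (r k : ℕ) {γ : ℝ} (hγle : γ ≤ γbar) (v : Fin (k + 1) → ℝ) (hv : v ∈ HistBox γ k) :
    |β k v - bInf k| ≤ 2 * τ r + C r * γ ^ 2 := by
  have hv' : v ∈ HistBox γbar k := fun i => ⟨(hv i).1, (hv i).2.trans hγle⟩
  have hsq := squeeze_norm hA hB hb r k v hv'
  have hγ0 : 0 ≤ γ := (hv 0).1.le.trans (hv 0).2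
  have hl1 : ‖v‖ ≤ γ := (pi_norm_le_iff_of_nonneg hγ0).2 fun i => by rw [Real.norm_eq_abs, abs_of_pos (hv i).1]; exact (hv i).2
  have hl0 : 0 ≤ ‖v‖ := norm_nonneg _
  have hmono : C r * ‖v‖ ^ 2 ≤ C r * γ ^ 2 := by
    apply mul_le_mul_of_nonneg_left _ (hC r)
    nlinarith
  linarith

/-- **THE PER-SCALE ANCHOR IS DERIVED** (not hypothesised): `ScaleAnchor β b∞` — the limiting one-loop numbers ARE the in-box corner limits of `β`.
(Honours `Negative/Anchor13FalseOfTwoBaseHistories`: the anchor is an OUTPUT of HYP A + HYP B, pinned to ONE sequence.) [folklore] -/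
theorem scaleAnchor_bInf {bInf : ℕ → ℝ} (hb : ∀ k r, |b0f r k - bInf k| ≤ τ r) : ScaleAnchor β bInf := by
  intro k δ hδ
  -- depth first: 2 τ r ≤ δ/2
  have hev : ∀ᶠ r in atTop, τ r < δ / 4 := (tendsto_order.1 hτ0).2 _ (by positivity)
  obtain ⟨r, hr⟩ := hev.exists
  -- box after: C r γ² ≤ δ/2 with γ := min γ̄ (δ / (2 (C r + 1) γ̄))
  have hC1 : 0 < C r + 1 := by linarith [hC r]
  set γ := min γbar (δ / (2 * (C r + 1) * γbar)) with hγdef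
  have hγpos : 0 < γ := lt_min hγ (by positivity)
  have hγle : γ ≤ γbar := min_le_left _ _
  have hγle' : γ ≤ δ / (2 * (C r + 1) * γbar) := min_le_right _ _
  refine ⟨γ, hγpos, fun p hp => ?_⟩
  have hsq := squeeze_at_bInf hC hA hB hb r k hγle p hp
  have b1 : C r * γ ^ 2 ≤ C r * (γbar * γ) := by
    apply mul_le_mul_of_nonneg_left _ (hC r); nlinarith
  have b2 : C r * (γbar * γ) ≤ C r * (γbar * (δ / (2 * (C r + 1) * γbar))) := by
    apply mul_le_mul_of_nonneg_left _ (hC r)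
    exact mul_le_mul_of_nonneg_left hγle' hγ.le
  have b3 : C r * (γbar * (δ / (2 * (C r + 1) * γbar))) = δ / 2 * (C r / (C r + 1)) := by
    field_simp
  have b4 : C r / (C r + 1) ≤ 1 := by rw [div_le_one hC1]; linarith
  have b5 : δ / 2 * (C r / (C r + 1)) ≤ δ / 2 := by
    have := mul_le_mul_of_nonneg_left b4 (by positivity : (0:ℝ) ≤ δ / 2); simpa using this
  linarith

/-- **A CONSTANT REMAINDER AT EVERY CAP** on some box inside `]0, γ̄]`: for every `s > 0` a level `γ₀ ∈ ]0, γ̄]` with `ConstRemainder β b∞ s γ₀`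
(so the END's cap `r ≤ s` is met with `le_rfl` whatever the drift slope `s` is — threshold-free, κ-free). [folklore] -/
theorem constRemainder_bInf {bInf : ℕ → ℝ} (hb : ∀ k r, |b0f r k - bInf k| ≤ τ r) {s : ℝ} (hs : 0 < s) :
    ∃ γ₀ : ℝ, 0 < γ₀ ∧ γ₀ ≤ γbar ∧ ConstRemainder β bInf s γ₀ := by
  have hev : ∀ᶠ r in atTop, τ r < s / 4 := (tendsto_order.1 hτ0).2 _ (by positivity)
  obtain ⟨r, hr⟩ := hev.exists
  have hC1 : 0 < C r + 1 := by linarith [hC r]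
  set γ := min γbar (s / (2 * (C r + 1) * γbar)) with hγdef
  have hγpos : 0 < γ := lt_min hγ (by positivity)
  have hγle : γ ≤ γbar := min_le_left _ _
  have hγle' : γ ≤ s / (2 * (C r + 1) * γbar) := min_le_right _ _
  refine ⟨γ, hγpos, hγle, fun k p hp => ?_⟩
  have hsq := squeeze_at_bInf hC hA hB hb r k hγle p hp
  have b1 : C r * γ ^ 2 ≤ C r * (γbar * γ) := by
    apply mul_le_mul_of_nonneg_left _ (hC r); nlinarith
  have b2 : C r * (γbar * γ) ≤ C r * (γbar * (s / (2 * (C r + 1) * γbar))) := by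
    apply mul_le_mul_of_nonneg_left _ (hC r)
    exact mul_le_mul_of_nonneg_left hγle' hγ.le
  have b3 : C r * (γbar * (s / (2 * (C r + 1) * γbar))) = s / 2 * (C r / (C r + 1)) := by
    field_simp
  have b4 : C r / (C r + 1) ≤ 1 := by rw [div_le_one hC1]; linarith
  have b5 : s / 2 * (C r / (C r + 1)) ≤ s / 2 := by
    have := mul_le_mul_of_nonneg_left b4 (by positivity : (0:ℝ) ≤ s / 2); simpa using this
  linarith

/- ED.3 (F-E): the ed.1∕2 lemma `tendsto_last_bInf` («β_{k+1}(w[g_k ↦ g]) → b∞_k as g → 0⁺ at every base `w`») is WITHDRAWN, not because it was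
false as a consequence of the last-entry HYP A (it was a theorem of it), but because the last-entry HYP A itself is the wrong currency on the tree object: off-run,
`g_k` is only the gauge-fixing strength of the last step (`B12Eq019ActionBody.integrand`, `printedSeq`), so a base-line limit in `g_k` alone is a statement about the
gauge fixing, not about the semiclassical parameter.  The CORNER statements (`scaleAnchor_bInf`, `constRemainder_bInf`) are what the END consumes and are kept;
this is CRIT-2 g3's «corner, not base line» with a structural reason. -/

end Abstract

/-! ## §1b THE PACKAGE, ITS KERNEL (anchor + constant remainder at every cap), AND THE HONEST COLLAPSE CERTIFICATE (run by this seat before any critic): as a TYPE, the abstract package is EXACTLY a «parabolic-family modulus at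
history-free numbers» — `∀ r, |β_{k+1}(v) − b_k| ≤ τ_r + C_r·‖v‖²` with `τ_r → 0` — i.e. a rate-free box modulus of a particular countable-inf-of-parabolas shape
(between the (190) road's LINEAR modulus `C·g_k` and idea-5's bare `ω`).  So the ∃βf-layer of `ApproxLaplacePkg` is PLUMBING ((5d)-class currency); the CONTENT of
the line is the PINNED instance `βf := betaFin F θ` (§4: a tree object, the truncated (1.22) of the depth-`r` windowed kernel), which the collapse below cannot meet —
there `βf` is not ours to choose, and HYP A ∕ HYP B become two separately falsifiable statements ABOUT THAT OBJECT (§6). -/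

section Collapse

/-- **THE APPROXIMANT-LAPLACE PACKAGE for a β** (HYPOTHESIS SHAPE): depth-indexed finite-volume β's `βf r` (INTENDED INSTANCE at the record: `betaFin F θ r`
of §4 = (1.22) of the depth-`r` WINDOWED kernel `Node00.polWindow F (k+1+r) (k+1) …` of the merged step functional — the object whose `limUnder` IS the
record's β), history-free finite-volume one-loop numbers `b0f r k`, a Laplace constant `C r ≥ 0` per depth (dimension-dependent — allowed!), a null
thermodynamic modulus `τ` (ed.2: no monotonicity), a box `γ̄ > 0`; HYP A `FinLaplace` + HYP B `ThermoRate`. [cite: Balaban1987RG1, (1.21)–(1.22) p.264 and (2.12)–(2.14) p.268] -/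
def ApproxLaplacePkg (β : HBeta) : Prop :=
  ∃ (βf : ℕ → HBeta) (b0f : ℕ → ℕ → ℝ) (C τ : ℕ → ℝ) (γbar : ℝ),
    0 < γbar ∧ (∀ r, 0 ≤ C r) ∧ Tendsto τ atTop (𝓝 0) ∧ FinLaplace βf b0f C γbar ∧ ThermoRate β βf τ γbar

/-- **PACKAGE ⟹ limiting one-loop numbers `b∞` WITH the per-scale anchor AND a constant remainder at EVERY cap** (kernel of the line). [folklore] -/
theorem anchor_and_constRemainder_of_pkg {β : HBeta} (h : ApproxLaplacePkg β) :
    ∃ bInf : ℕ → ℝ, ScaleAnchor β bInf ∧ ∀ s : ℝ, 0 < s → ∃ γ₀ : ℝ, 0 < γ₀ ∧ ConstRemainder β bInf s γ₀ := by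
  obtain ⟨βf, b0f, C, τ, γbar, hγ, hC, hτ0, hA, hB⟩ := h
  obtain ⟨bInf, hb⟩ := exists_bInf hγ hC hA hB hτ0
  have hb' : ∀ k r, |b0f r k - bInf k| ≤ τ r := fun k r => (hb k).2 r
  refine ⟨bInf, scaleAnchor_bInf hγ hC hA hB hτ0 hb', fun s hs => ?_⟩
  obtain ⟨γ₀, hγ₀, -, hrem⟩ := constRemainder_bInf hγ hC hA hB hτ0 hb' hs
  exact ⟨γ₀, hγ₀, hrem⟩


/-- The PARABOLIC-FAMILY MODULUS of `β` at history-free numbers `b` on `]0, γ̄]`: for every depth-label `r`, `|β_{k+1}(v) − b_k| ≤ τ r + C r · ‖v‖²` (box-size currency, ed.3). [folklore] -/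
def ParabolicModulus (β : HBeta) (b : ℕ → ℝ) (C τ : ℕ → ℝ) (γbar : ℝ) : Prop :=
  ∀ (r k : ℕ) (v : Fin (k + 1) → ℝ), v ∈ HistBox γbar k → |β k v - b k| ≤ τ r + C r * ‖v‖ ^ 2

/-- Clipping to `[−M, M]` lands in `[−M, M]`. [folklore] -/
theorem abs_clip_le {e M : ℝ} (hM : 0 ≤ M) : |max (-M) (min M e)| ≤ M := by
  rw [abs_le]; exact ⟨le_max_left _ _, max_le (by linarith) (min_le_left _ _)⟩

/-- Clipping `e` to `[−M, M]` moves it by at most the excess `t ≥ 0` when `|e| ≤ t + M`. [folklore] -/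
theorem abs_clip_sub_le {e M t : ℝ} (hM : 0 ≤ M) (ht : 0 ≤ t) (h : |e| ≤ t + M) : |max (-M) (min M e) - e| ≤ t := by
  obtain ⟨h1, h2⟩ := abs_le.1 h
  rw [abs_le]
  rcases le_total M e with hMe | heM
  · rw [min_eq_left hMe, max_eq_right (by linarith)]; constructor <;> linarith
  · rw [min_eq_right heM]
    rcases le_total (-M) e with h3 | h3
    · rw [max_eq_right h3]; constructor <;> linarith
    · rw [max_eq_left h3]; constructor <;> linarith

/-- **★ COLLAPSE CERTIFICATE — `ApproxLaplacePkg β` ⟺ a parabolic-family modulus at SOME history-free numbers.**  (⟹: the squeeze at `b∞`; ⟸: clip `β − b` to the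
parabola `±C_r g²` — the clipped function serves as `βf r`, `b` itself as `b0f r`.)  Consequence: every claim of this line that is not about the PINNED `betaFin`
is (5d)-class plumbing, and is advertised as such. [folklore] -/
theorem approxLaplacePkg_iff_parabolic {β : HBeta} :
    ApproxLaplacePkg β ↔
      ∃ (b : ℕ → ℝ) (C τ : ℕ → ℝ) (γbar : ℝ), 0 < γbar ∧ (∀ r, 0 ≤ C r) ∧ Tendsto τ atTop (𝓝 0) ∧ ParabolicModulus β b C τ γbar := by
  constructor
  · rintro ⟨βf, b0f, C, τ, γbar, hγ, hC, hτ0, hA, hB⟩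
    obtain ⟨bInf, hb⟩ := exists_bInf hγ hC hA hB hτ0
    refine ⟨bInf, C, fun r => 2 * τ r, γbar, hγ, hC, by simpa using hτ0.const_mul 2, fun r k v hv => ?_⟩
    exact squeeze_norm hA hB (fun k r => (hb k).2 r) r k v hv
  · rintro ⟨b, C, τ, γbar, hγ, hC, hτ0, hP⟩
    refine ⟨fun r k v => b k + max (-(C r * ‖v‖ ^ 2)) (min (C r * ‖v‖ ^ 2) (β k v - b k)),
      fun _ k => b k, C, τ, γbar, hγ, hC, hτ0, fun r k v hv => ?_, fun r k v hv => ?_⟩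
    · have hM : 0 ≤ C r * ‖v‖ ^ 2 := mul_nonneg (hC r) (sq_nonneg _)
      have := abs_clip_le (e := β k v - b k) hM
      simpa [add_sub_cancel_left] using this
    · have hM : 0 ≤ C r * ‖v‖ ^ 2 := mul_nonneg (hC r) (sq_nonneg _)
      -- `0 ≤ τ r`: read the parabolic bound along the constant histories `(g, …, g)`, `g → 0⁺` (`le_of_forall_sq`)
      have hτr : 0 ≤ τ r := by
        refine le_of_forall_sq hγ (hC r) fun g hg hgle => ?_
        have hw : (fun _ : Fin (k + 1) => g) ∈ HistBox γbar k := fun _ => ⟨hg, hgle⟩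
        have hng : ‖(fun _ : Fin (k + 1) => g)‖ = g := by rw [pi_norm_const, Real.norm_eq_abs, abs_of_pos hg]
        have h1 := hP r k (fun _ => g) hw
        rw [hng] at h1
        linarith [abs_nonneg (β k (fun _ => g) - b k)]
      have hclip := abs_clip_sub_le hM hτr (hP r k v hv)
      have e : b k + max (-(C r * ‖v‖ ^ 2)) (min (C r * ‖v‖ ^ 2) (β k v - b k)) - β k v
          = max (-(C r * ‖v‖ ^ 2)) (min (C r * ‖v‖ ^ 2) (β k v - b k)) - (β k v - b k) := by ring
      rw [e]; exact hclip

end Collapse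



/-! ## §2 At the Stage-13 record: the package, the DERIVED anchor, and the junction to the crux BY NAME -/

section Record

/-- **v7c's 2ᶜᴰ text VERBATIM** (plan g84 `D84-K2V7/K2Skeleton13SepCoPHv7c.lean` :535, the (D1)-side registered stub `stub_cornerDriftPos13 : CornerDriftPos`):
«prefix → ∃ b s A, ScaleAnchor D.βfun b ∧ 0 < s ∧ OneLoopDrift s A b».  Restated here ONLY so that this sketch composes by name before a `K2V7Defs` lands; the
text is byte-identical.  HYPOTHESIS SHAPE, never a fact. [cite: Balaban1987RG1, (1.3) p.260, (1.22) p.264 and (2.12)–(2.13) p.268] -/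
def CornerDriftPos : Prop :=
  ∀ (F : T4Family) (θ : Node00.Stage13HParams F 2) (hP : θ.Provisos₁₃SepCoPH F 2), (θ.ZhUnity F 2 ∧ θ.SlotsNondegenerate₁₃ F 2) → θ.Admissible F 2 →
    B16.EndStatementBPrinted (Node00.datumOfRecord₁₃SepCoPH F 2 θ hP).C → Window13 F θ hP →
    ∃ (b : ℕ → ℝ) (s A : ℝ), ScaleAnchor (Node00.datumOfRecord₁₃SepCoPH F 2 θ hP).βfun b ∧ 0 < s ∧ OneLoopDrift s A b

/-- **2ᶜᴰ HERE ≡ 2ᶜᴰ BY ITS TREE NAME** (ed.3b): the inline copy above IS DEF-1's `Theorems/BalabanUVNodesK2V7Defs.CornerDriftPos` (p613755 :118, itself `Iff.rfl` to the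
REGISTERED v7c :542 text by `cornerDriftPos_iff_inline` :135) — `Iff.rfl`, so every composition below can be fed the tree-named hypothesis. [folklore] -/
theorem cornerDriftPos_iff_tree :
    CornerDriftPos ↔ Summit.QuantumFields.YangMills.Theorems.BalabanUVNodesK2V7Defs.CornerDriftPos :=
  Iff.rfl

/-- **TEXT 1ᴬᴸ — THIS LINE's (D4)∧(C) STUB TEXT** (an ALTERNATIVE to v7c's 1ᶜᴿ `RunChain190AtCornerDriftSlope`, same prefix, same partner 2ᶜᴰ): at every tuple of
the crux's prefix, the approximant-Laplace package for the datum's β AND run-wise (C) `SurvCont` at all small levels ((C) is NOT supplied by the lever —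
road (D5), as for every (D4) supplier).  No `(190)`-chain representation, no cap, no `B13.Consts`, no threshold seam: the cap against ANY slope is an OUTPUT
(`anchor_and_constRemainder_of_pkg`).  HYPOTHESIS SHAPE ∕ obligation text, never a fact; size: HYP A = M (finite-dimensional analysis, `LogMomentBound`) +
L (format inputs (MB)∕(UD)-class, shared), HYP B = L (k-uniform locality of the (1.21) limit, (UD)-class). [cite: Balaban1987RG1, Thm 3 + (1.18)–(1.22) pp.263–264, (2.12)–(2.14) p.268] -/
def ApproxLaplace13 : Prop :=
  ∀ (F : T4Family) (θ : Node00.Stage13HParams F 2) (hP : θ.Provisos₁₃SepCoPH F 2), (θ.ZhUnity F 2 ∧ θ.SlotsNondegenerate₁₃ F 2) → θ.Admissible F 2 →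
    B16.EndStatementBPrinted (Node00.datumOfRecord₁₃SepCoPH F 2 θ hP).C → Window13 F θ hP →
    ApproxLaplacePkg (Node00.datumOfRecord₁₃SepCoPH F 2 θ hP).βfun ∧
    ∃ γc : ℝ, 0 < γc ∧ ∀ γ : ℝ, 0 < γ → γ ≤ γc → SurvCont (Node00.datumOfRecord₁₃SepCoPH F 2 θ hP).βfun γ

/-- **★★ THE JUNCTION — {2ᶜᴰ, 1ᴬᴸ} ⟹ THE CRUX DECL BY NAME**: obtain v7c's anchored drifting corner sequence `b`; obtain this line's `b∞` with ITS anchor;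
`b = b∞` by `ScaleAnchor.eq` (the tree's `eq_of_anchors`); take the constant remainder AT THE DRIFT SLOPE `s` itself (cap met with `le_rfl`), restrict to
runs (`runConstRemainder_of_constRemainder`), shrink to the (C)-level, and call the tree's generic END `endpointExistence_of_drift_runConstRemainder_survCont`
at the datum's `fwd`.  CONDITIONAL on the two displayed texts; K2⁷ NOT closed; nothing of Bałaban asserted.
[cite: Balaban1987RG1, Thm 2 p.259 (first sentence), Thm 3 p.264, (2.12)–(2.14) p.268 and (5.10) p.293] -/
theorem EndpointGivenBR13SepCoPH_of_cornerDrift_approxLaplace (h₁ : CornerDriftPos) (h₂ : ApproxLaplace13) :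
    Summit.QuantumFields.YangMills.Theses.BalabanUVNodes.EndpointGivenBR13SepCoPH := by
  intro F θ hP hU hθ hB hwin
  obtain ⟨b, s, A, hanch, hs, hdrift⟩ := h₁ F θ hP hU hθ hB hwin
  obtain ⟨hpkg, γc, hγc, hcont⟩ := h₂ F θ hP hU hθ hB hwin
  obtain ⟨bInf, hanch', hrem⟩ := anchor_and_constRemainder_of_pkg hpkg
  have hbb : b = bInf := hanch.eq hanch'
  subst hbb
  obtain ⟨γ₀, hγ₀, hrem₀⟩ := hrem s hs
  have hγ₁ : 0 < min γ₀ γc := lt_min hγ₀ hγc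
  have hremR : RunConstRemainder (Node00.datumOfRecord₁₃SepCoPH F 2 θ hP).βfun b s (min γ₀ γc) :=
    runConstRemainder_of_constRemainder (hrem₀.mono (min_le_left _ _))
  have hsc : SurvCont (Node00.datumOfRecord₁₃SepCoPH F 2 θ hP).βfun (min γ₀ γc) := hcont _ hγ₁ (min_le_right _ _)
  exact endpointExistence_of_drift_runConstRemainder_survCont (Node00.datumOfRecord₁₃SepCoPH F 2 θ hP).fwd hγ₁ hdrift hremR le_rfl hsc

/-- **USE FORM — the package ALONE supplies 2ᶜᴰ's ANCHOR half**: if at every tuple the package holds and the limiting numbers it produces drift positively,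
then `CornerDriftPos` (so on this line 2ᶜᴰ reduces to «(D1) + AF sign for the limits of the finite-volume one-loop numbers», pure β-cell content). [folklore] -/
theorem cornerDriftPos_of_pkg_drift
    (h : ∀ (F : T4Family) (θ : Node00.Stage13HParams F 2) (hP : θ.Provisos₁₃SepCoPH F 2), (θ.ZhUnity F 2 ∧ θ.SlotsNondegenerate₁₃ F 2) → θ.Admissible F 2 →
      B16.EndStatementBPrinted (Node00.datumOfRecord₁₃SepCoPH F 2 θ hP).C → Window13 F θ hP →
      ApproxLaplacePkg (Node00.datumOfRecord₁₃SepCoPH F 2 θ hP).βfun ∧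
      ∀ bInf : ℕ → ℝ, ScaleAnchor (Node00.datumOfRecord₁₃SepCoPH F 2 θ hP).βfun bInf → ∃ s A : ℝ, 0 < s ∧ OneLoopDrift s A bInf) :
    CornerDriftPos := by
  intro F θ hP hU hθ hB hwin
  obtain ⟨hpkg, hdr⟩ := h F θ hP hU hθ hB hwin
  obtain ⟨bInf, hanch, -⟩ := anchor_and_constRemainder_of_pkg hpkg
  obtain ⟨s, A, hs, hd⟩ := hdr bInf hanch
  exact ⟨bInf, s, A, hanch, hs, hd⟩

end Record

/-! ## §2b KEYED TO THE TREE's (5d) SOCKET BY NAME (an4 g153 p613430 `Theorems/BalabanUVNodesK2RunRowsSandwich.lean` §4,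
`EndpointGivenBR13SepCoPH_of_cornerDriftK_cornerRunConstRemainderK` :255): 1ᴬᴸ supplies that theorem's SECOND hypothesis — the display-free weak currency
«at every anchored drifting `b`, SOME window with a run-wise constant remainder of radius `r ≤ s` and (C)» — with `r := s` (`le_rfl`) and WITHOUT reading the drift
(the package pays every cap); the FIRST hypothesis is v7c's registered 2ᶜᴰ (`Window13` unfolds by `rfl` to the socket's inline window). -/

section KeyedToTree

open Summit.QuantumFields.YangMills.Theorems.BalabanUVNodesK2RunRowsSandwich (EndpointGivenBR13SepCoPH_of_cornerDriftK_cornerRunConstRemainderK)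

/-- **1ᴬᴸ ⟹ an4's (5d) weak-currency hypothesis `h₂`** (the drift binders are accepted and NOT used: the package gives a constant remainder at EVERY cap,
in particular at the drift slope `s` itself). [folklore] -/
theorem cornerRunConstRemainderK_of_approxLaplace13 (h₂ : ApproxLaplace13) :
    ∀ (F : T4Family) (θ : Node00.Stage13HParams F 2) (hP : θ.Provisos₁₃SepCoPH F 2),
      (θ.ZhUnity F 2 ∧ θ.SlotsNondegenerate₁₃ F 2) → θ.Admissible F 2 →
      B16.EndStatementBPrinted (Node00.datumOfRecord₁₃SepCoPH F 2 θ hP).C →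
      (∃ γ₁ : ℝ, 0 < γ₁ ∧ ∀ γ : ℝ, 0 < γ → γ ≤ γ₁ →
        ∃ P : B12.RunParams, 1 ≤ P.K ∧ ((Node00.datumOfRecord₁₃SepCoPH F 2 θ hP).C P).flow.InInterval γ P.K) →
      ∀ (b : ℕ → ℝ) (s A : ℝ), ScaleAnchor (Node00.datumOfRecord₁₃SepCoPH F 2 θ hP).βfun b → 0 < s → OneLoopDrift s A b →
      ∃ γ₀ r : ℝ, 0 < γ₀ ∧ r ≤ s ∧ RunConstRemainder (Node00.datumOfRecord₁₃SepCoPH F 2 θ hP).βfun b r γ₀ ∧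
        SurvCont (Node00.datumOfRecord₁₃SepCoPH F 2 θ hP).βfun γ₀ := by
  intro F θ hP hU hθ hB hwin b s A hanch hs _
  obtain ⟨hpkg, γc, hγc, hcont⟩ := h₂ F θ hP hU hθ hB hwin
  obtain ⟨bInf, hanch', hrem⟩ := anchor_and_constRemainder_of_pkg hpkg
  have hbb : b = bInf := hanch.eq hanch'
  subst hbb
  obtain ⟨γ₀, hγ₀, hrem₀⟩ := hrem s hs
  exact ⟨min γ₀ γc, s, lt_min hγ₀ hγc, le_rfl, runConstRemainder_of_constRemainder (hrem₀.mono (min_le_left _ _)),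
    hcont _ (lt_min hγ₀ hγc) (min_le_right _ _)⟩

/-- **★★ THE JUNCTION THROUGH THE TREE SOCKET, BY NAME**: {2ᶜᴰ, 1ᴬᴸ} ⟹ the crux decl via an4's `EndpointGivenBR13SepCoPH_of_cornerDriftK_cornerRunConstRemainderK`
(p613430; this line = one more supplier of its weak currency, next to v7c's 1ᶜᴿ via `cornerRunConstRemainderK_of_cornerRunChainK` :364).  CONDITIONAL on the two
displayed texts; K2⁷ NOT closed. [cite: Balaban1987RG1, Thm 2 p.259 (first sentence), Thm 3 p.264 and (2.12)–(2.14) p.268] -/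
theorem EndpointGivenBR13SepCoPH_of_cornerDrift_approxLaplace_viaTree (h₁ : CornerDriftPos) (h₂ : ApproxLaplace13) :
    Summit.QuantumFields.YangMills.Theses.BalabanUVNodes.EndpointGivenBR13SepCoPH :=
  EndpointGivenBR13SepCoPH_of_cornerDriftK_cornerRunConstRemainderK h₁ (cornerRunConstRemainderK_of_approxLaplace13 h₂)

end KeyedToTree

/-! ## §3 THE FIRST GENUINE LEMMA OF THE LINE, TYPED (unproved `Prop`, Mathlib only): the finite-dimensional complex-Gaussian LOG-MOMENT bound
with the odd `O(g)` term killed by parity — `|log 𝔼_Q[𝟙_D · e^{g X₁ + g² X₂}]| ≤ C(n, c, M, ε) · g²`. -/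

section FirstLemma

/-- The complex quadratic form of a matrix on real vectors: `x ↦ Σᵢⱼ Aᵢⱼ xᵢ xⱼ`. [folklore] -/
def quadC {n : ℕ} (A : Matrix (Fin n) (Fin n) ℂ) (x : Fin n → ℝ) : ℂ :=
  ∑ i, ∑ j, A i j * (x i : ℂ) * (x j : ℂ)

/-- **S-LAP — THE GAUSSIAN LOG-MOMENT LEMMA (HYPOTHESIS SHAPE of an elementary theorem; the line's first prover target, size M)**.  DICTIONARY to (2.13)
p.268 at depth `r`: `x` = the `n(r)` scaled fluctuation variables `B = B′/g` of the fibre (`g` = the main-term coupling of the step, `= g_k` on a (0.18)-run) over the background `U_{k+1}(e^{iW})` (axial gauge, linear chart);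
`A` = half the fluctuation quadratic form `Δ^{(k)}` (complex symmetric for complex `|W| ≤ ρ`, real part coercive — [13] ∕ B9–B10 + [15]); `g·X₁` = the ODD part of
the exponent (the cubic of the blocked classical action `𝒜_k` at its constrained minimiser, whose FIRST variation vanishes there, + `g·∂𝓔_k[X]` from the old
terms + odd chart∕Haar terms — every term of (2.12)'s integrand depends on `(g, X)` through `gX` and the overall `1/g²`, so `X^m` carries `g^{m−2}`: parity lock);
`g²·X₂` = the even rest; `D` = the (2.9) window `{|B′(b)| < ε₂₉}` in scaled variables (symmetric, between two sup-balls of radius `∝ ε/g`).  Conclusion: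
`E^{(k+1)}_{depth r} = O(C·g²)` POINTWISE in the background, `g` the main-term coupling of the step (of box size, ed.3), with `C = C(n(r), c, M, ε)` — dimension-dependent, which the squeeze of §1 tolerates.
Proof idea (not formalised): centred Gaussian ⇒ `𝔼[X₁ 𝟙_D] = 0`; `|e^u − 1 − u| ≤ |u|² e^{|u|}`; Gaussian domination `M ε (1 + ·) < c/2` for `ε ≤ ε₀`; tails
`μ_Q(D^c) ≤ e^{−c′ε²/g²} ≤ g²`. [folklore] -/
def LogMomentBound : Prop :=
  ∀ (n : ℕ) (c M : ℝ), 0 < c → c ≤ 1 → 0 ≤ M →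
    ∃ ε₀ : ℝ, 0 < ε₀ ∧ ∀ ε : ℝ, 0 < ε → ε ≤ ε₀ →
      ∃ Cst g₀ : ℝ, 0 < g₀ ∧ ∀ g : ℝ, 0 < g → g ≤ g₀ →
        ∀ (A : Matrix (Fin n) (Fin n) ℂ) (X₁ X₂ : (Fin n → ℝ) → ℂ) (D : Set (Fin n → ℝ)),
          A.IsSymm → (∀ i j, ‖A i j‖ ≤ c⁻¹) → (∀ x, c * ‖x‖ ^ 2 ≤ (quadC A x).re) →
          Continuous X₁ → Continuous X₂ → (∀ x, X₁ (-x) = -X₁ x) →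
          (∀ x, ‖X₁ x‖ ≤ M * (‖x‖ + ‖x‖ ^ 3)) → (∀ x, ‖x‖ ≤ ε / g → ‖X₂ x‖ ≤ M * (1 + ‖x‖ ^ 4)) →
          MeasurableSet D → (∀ x ∈ D, -x ∈ D) →
          Metric.closedBall (0 : Fin n → ℝ) (c * ε / g) ⊆ D → D ⊆ Metric.closedBall (0 : Fin n → ℝ) (ε / g) →
          ‖Complex.log ((∫ x in D, Complex.exp (-quadC A x + (g : ℂ) * X₁ x + (g : ℂ) ^ 2 * X₂ x)) /
              (∫ x : Fin n → ℝ, Complex.exp (-quadC A x)))‖ ≤ Cst * g ^ 2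

end FirstLemma


/-! ## §4 KERNEL CURRENCY FOR HYP B: truncated second moments, the (5.10)-majorant's tail, and
«(VC) volume convergence on the window + (UD) uniform decay ⟹ a k-UNIFORM THERMODYNAMIC RATE» (kernel-checked, Mathlib + `B12Sec2to5` only) -/

section KernelCurrency

open Literature.MathematicalPhysics.QuantumFieldTheory.Balaban1983to89.B12Sec2to5 (l1 Decay510 majorant_summable abs_term_le_of_decay510
  secondMoment_abs_le_of_decay510)
-- (`tendsto_tsum_compl_atTop_zero`, `Summable.sum_add_tsum_compl`, `tsum_of_norm_bounded`: Mathlib)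

/-- The centred cube `[−R, R]⁴ ∩ ℤ⁴` (the WINDOW of the truncated second moment; at depth `r` the cube of radius `r` fits inside one period of the torus of
`2L^{m+r}` sites per direction). [folklore] -/
def cube (R : ℕ) : Finset (Fin 4 → ℤ) := Fintype.piFinset fun _ : Fin 4 => Finset.Icc (-(R : ℤ)) R

/-- **THE TRUNCATED SECOND MOMENT** `Σ_{z ∈ [−R,R]⁴} Π_{μν}(z) z_μ z_ν` — (1.22) ∕ (5.42) read on a finite window (a FINITE sum: no summability, no junk value).
[cite: Balaban1987RG1, (1.22) p.264 and (5.42) p.297] -/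
def truncMoment (R : ℕ) (P : B12Beta.Kernel 4) (μ ν : Fin 4) : ℝ :=
  ∑ z ∈ cube R, P μ ν z * (z μ : ℝ) * (z ν : ℝ)

/-- The tail of the (5.10)-majorant `|z|₁² e^{−δ₁|z|₁}` outside the cube of radius `R`. [folklore] -/
def tailMajorant (δ₁ : ℝ) (R : ℕ) : ℝ :=
  ∑' z : {z : Fin 4 → ℤ // z ∉ cube R}, l1 z.1 ^ 2 * Real.exp (-δ₁ * l1 z.1)

/-- The cubes increase. [folklore] -/
theorem cube_mono : Monotone cube := by
  intro R R' h z hz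
  simp only [cube, Fintype.mem_piFinset, Finset.mem_Icc] at hz ⊢
  intro i
  have := hz i
  constructor <;> omega

/-- The cubes exhaust `ℤ⁴`. [folklore] -/
theorem exists_mem_cube (z : Fin 4 → ℤ) : ∃ R : ℕ, z ∈ cube R := by
  refine ⟨∑ i, (z i).natAbs, ?_⟩
  simp only [cube, Fintype.mem_piFinset, Finset.mem_Icc]
  intro i
  have h1 : (z i).natAbs ≤ ∑ j, (z j).natAbs := Finset.single_le_sum (f := fun j => (z j).natAbs) (fun _ _ => Nat.zero_le _) (Finset.mem_univ i)
  constructor <;> omega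

/-- `cube R → ⊤` in the order of finite sets. [folklore] -/
theorem tendsto_cube_atTop : Tendsto cube atTop atTop := by
  refine Monotone.tendsto_atTop_atTop cube_mono fun s => ?_
  classical
  choose N hN using exists_mem_cube
  exact ⟨s.sup N, fun z hz => cube_mono (Finset.le_sup hz) (hN z)⟩

/-- **THE MAJORANT's TAIL VANISHES** as the window grows (`tendsto_tsum_compl_atTop_zero` along the exhausting cubes; no rate is claimed or needed, and none is asserted
for a non-summable majorant either — the statement is rate-free bookkeeping). [folklore] -/
theorem tendsto_tailMajorant (δ₁ : ℝ) : Tendsto (tailMajorant δ₁) atTop (𝓝 0) :=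
  (tendsto_tsum_compl_atTop_zero fun z : Fin 4 → ℤ => l1 z ^ 2 * Real.exp (-δ₁ * l1 z)).comp tendsto_cube_atTop

/-- **TRUNCATION ERROR UNDER (5.10)**: `|Σ_{|z|≤R} Π z z − Σ_{ℤ⁴} Π z z| ≤ C · tail(δ₁, R)` (dominated tails; `secondMoment_abs_le_of_decay510` gives the summability).
[cite: Balaban1987RG1, (5.10) p.293 and (5.42) p.297] -/
theorem abs_truncMoment_sub_secondMoment_le {P : B12Beta.Kernel 4} {C δ₁ : ℝ} {μ ν : Fin 4} (hδ : 0 < δ₁) (h : Decay510 (P μ ν) C δ₁) (R : ℕ) :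
    |truncMoment R P μ ν - B12Beta.secondMoment P μ ν| ≤ C * tailMajorant δ₁ R := by
  obtain ⟨hS, -⟩ := secondMoment_abs_le_of_decay510 hδ h
  have hsplit := hS.sum_add_tsum_compl (s := cube R)
  have hdiff : truncMoment R P μ ν - B12Beta.secondMoment P μ ν =
      -∑' z : ↥((cube R : Finset (Fin 4 → ℤ)) : Set (Fin 4 → ℤ))ᶜ, P μ ν z * (z.1 μ : ℝ) * (z.1 ν : ℝ) := by
    rw [B12Beta.secondMoment, ← hsplit, truncMoment]; ring
  rw [hdiff, abs_neg]
  have hM : Summable fun z : ↥((cube R : Finset (Fin 4 → ℤ)) : Set (Fin 4 → ℤ))ᶜ => C * (l1 z.1 ^ 2 * Real.exp (-δ₁ * l1 z.1)) :=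
    ((majorant_summable hδ 4).mul_left C).subtype _
  have hpt : ∀ z : ↥((cube R : Finset (Fin 4 → ℤ)) : Set (Fin 4 → ℤ))ᶜ, ‖P μ ν z * (z.1 μ : ℝ) * (z.1 ν : ℝ)‖ ≤ C * (l1 z.1 ^ 2 * Real.exp (-δ₁ * l1 z.1)) :=
    fun z => by rw [Real.norm_eq_abs]; exact abs_term_le_of_decay510 h μ ν z.1
  have hb := tsum_of_norm_bounded hM.hasSum hpt
  rw [Real.norm_eq_abs, tsum_mul_left] at hb
  exact hb

variable {β : HBeta}

/-- HYP B-i shape — **(VC) k-UNIFORM VOLUME CONVERGENCE ON THE WINDOW**: the depth-`r` finite-volume kernels `Pf r k v` and the limiting kernels `P k v` have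
truncated `(0,1)` second moments within `τ₁ r` of each other, for every scale `k` and every history of the box (the torus → `ℤ⁴` passage of (1.21), «This limit exists
by the localized representation (1.7)», WITH a k-uniform rate on the radius-`r` window).  HYPOTHESIS SHAPE. [cite: Balaban1987RG1, (1.21) p.264 and (1.7) p.261] -/
def VolConv (Pf : ℕ → (k : ℕ) → (Fin (k + 1) → ℝ) → B12Beta.Kernel 4) (P : (k : ℕ) → (Fin (k + 1) → ℝ) → B12Beta.Kernel 4) (τ₁ : ℕ → ℝ) (γbar : ℝ) : Prop :=
  ∀ (r k : ℕ) (v : Fin (k + 1) → ℝ), v ∈ HistBox γbar k → |truncMoment r (Pf r k v) 0 1 - truncMoment r (P k v) 0 1| ≤ τ₁ r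

/-- HYP B-ii shape — **(UD) UNIFORM (5.10)-DECAY OF THE LIMITING KERNELS ON THE BOX** (N17's `hU` ∕ n°79's (UD) ∕ `U3OfKernels.KernelDecay` class — an EXISTING
currency of the cell, here with ONE constant on the box).  HYPOTHESIS SHAPE. [cite: Balaban1987RG1, (5.10) p.293] -/
def UnifDecay (P : (k : ℕ) → (Fin (k + 1) → ℝ) → B12Beta.Kernel 4) (C δ₁ γbar : ℝ) : Prop :=
  ∀ (k : ℕ) (v : Fin (k + 1) → ℝ), v ∈ HistBox γbar k → Decay510 (P k v 0 1) C δ₁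

/-- **★ (VC) + (UD) ⟹ THE k-UNIFORM THERMODYNAMIC RATE (HYP B) for the truncated finite-volume moments**, with `τ r := τ₁ r + C · tail(δ₁, r)` — for ANY β that IS
the `(0,1)` second moment of the limiting kernels on the box.  (Both inputs are g²-FREE, O(1)-constant statements: the `‖v‖²` of the line comes from HYP A alone.)
[cite: Balaban1987RG1, (1.21)–(1.22) p.264 and (5.10) p.293] -/
theorem thermoRate_of_volConv_unifDecay {Pf : ℕ → (k : ℕ) → (Fin (k + 1) → ℝ) → B12Beta.Kernel 4} {P : (k : ℕ) → (Fin (k + 1) → ℝ) → B12Beta.Kernel 4}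
    {τ₁ : ℕ → ℝ} {C δ₁ γbar : ℝ} (hδ : 0 < δ₁) (hVC : VolConv Pf P τ₁ γbar) (hUD : UnifDecay P C δ₁ γbar)
    (hβ : ∀ (k : ℕ) (v : Fin (k + 1) → ℝ), v ∈ HistBox γbar k → β k v = B12Beta.secondMoment (P k v) 0 1) :
    ThermoRate β (fun r k v => truncMoment r (Pf r k v) 0 1) (fun r => τ₁ r + C * tailMajorant δ₁ r) γbar := by
  intro r k v hv
  have h1 := hVC r k v hv
  have h2 := abs_truncMoment_sub_secondMoment_le hδ (hUD k v hv) r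
  rw [hβ k v hv]
  calc |truncMoment r (Pf r k v) 0 1 - B12Beta.secondMoment (P k v) 0 1|
      ≤ |truncMoment r (Pf r k v) 0 1 - truncMoment r (P k v) 0 1| + |truncMoment r (P k v) 0 1 - B12Beta.secondMoment (P k v) 0 1| :=
        abs_sub_le _ _ _
    _ ≤ τ₁ r + C * tailMajorant δ₁ r := add_le_add h1 h2

/-- … and that rate is NULL when `τ₁` is. [folklore] -/
theorem tendsto_rate_of_volConv_unifDecay {τ₁ : ℕ → ℝ} (C δ₁ : ℝ) (hτ₁ : Tendsto τ₁ atTop (𝓝 0)) :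
    Tendsto (fun r => τ₁ r + C * tailMajorant δ₁ r) atTop (𝓝 0) := by
  simpa using hτ₁.add ((tendsto_tailMajorant δ₁).const_mul C)

end KernelCurrency

/-! ## §5 THE PINNED OBJECTS AT THE RECORD (by name): the depth-`r` windowed kernel, its truncated β, the limiting kernel; the record's β IS the
second moment of the limiting kernel on the design box (`rfl` faces of def-T ∕ def-B) -/

section Concrete

variable (F : T4Family) (θ : Node00.Stage13HParams F 2)

/-- **THE DEPTH-`r` FINITE-VOLUME KERNEL OF RECORD** at scale `k` and history `hist`: (1.21) windowed into `ℤ⁴` (`Node00.polWindow`, periodic in `z`) of the merged step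
functional of the `(k+1+r)`-th approximation — torus of `2L^{m+r}` sites per direction, the SAME family whose `limUnder` over the approximation index is the record's
`polLimit` kernel (β-slot transport `TβOfRecord₁₃ = TcanOfRecord`, (2.9) species `chiβOfRecord₁₃ θ = chiFixed29 θ.ν θ.ε₂₉`, both `rfl`).  A definition asserting nothing.
[cite: Balaban1987RG1, (1.21) p.264 and (1.6)–(1.7) p.261] -/
def finKernel13 (r k : ℕ) (hist : Fin (k + 1) → ℝ) : B12Beta.Kernel 4 := fun μ ν z =>
  letI := θ.instVβ₁; letI := θ.instVβ₂; letI := θ.instιβ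
  Node00.polWindow F (k + 1 + r) (k + 1)
    (Node00.mergedTermFamilyMatT F 2 (Node00.TβOfRecord₁₃ F 2) (Node00.chiβOfRecord₁₃ F 2 θ.toStage13Params) θ.εbg k hist (k + 1 + r)) θ.ρ8 θ.bV μ ν z

/-- **THE LIMITING KERNEL OF RECORD** at scale `k` and history `hist` (N17's `hU` object verbatim): `Node00.polLimit` of the same family. A definition asserting nothing.
[cite: Balaban1987RG1, (1.21) p.264] -/
def limKernel13 (k : ℕ) (hist : Fin (k + 1) → ℝ) : B12Beta.Kernel 4 :=
  letI := θ.instVβ₁; letI := θ.instVβ₂; letI := θ.instιβ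
  Node00.polLimit F (k + 1)
    (fun K => Node00.mergedTermFamilyMatT F 2 (Node00.TβOfRecord₁₃ F 2) (Node00.chiβOfRecord₁₃ F 2 θ.toStage13Params) θ.εbg k hist K) θ.ρ8 θ.bV

/-- **V-1 (ed.4) — THE (1.21) EXISTENCE CLAUSE FOR THE RECORD's FAMILY at scale `k` and history `hist`, BY NAME**: `Node00.PolLimitExists` of the very family whose
`polLimit` is `limKernel13` — every windowed finite-volume kernel entry converges as the approximation index `K → ∞`.  An ESTIMATE of print ([I] p.264 «This limit exists by
the localized representation (1.7)»; [III] §3), displayed as a HYPOTHESIS SHAPE, never asserted; WITHOUT it `limKernel13` is the junk value of `limUnder` (CRIT-1 g5 V-1).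
[cite: Balaban1987RG1, (1.21) p.264 and (1.7) p.261] -/
def PolLimit13 (k : ℕ) (hist : Fin (k + 1) → ℝ) : Prop :=
  letI := θ.instVβ₁; letI := θ.instVβ₂; letI := θ.instιβ
  Node00.PolLimitExists F (k + 1)
    (fun K => Node00.mergedTermFamilyMatT F 2 (Node00.TβOfRecord₁₃ F 2) (Node00.chiβOfRecord₁₃ F 2 θ.toStage13Params) θ.εbg k hist K) θ.ρ8 θ.bV

/-- **V-1 — the existence clause ON A HISTORY BOX `]0, γ̄]`** (every scale, every history of the box). HYPOTHESIS SHAPE. [cite: Balaban1987RG1, (1.21) p.264] -/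
def PolLimitOnBox13 (γbar : ℝ) : Prop :=
  ∀ (k : ℕ) (v : Fin (k + 1) → ℝ), v ∈ HistBox γbar k → PolLimit13 F θ k v

/-- The box clause restricts to smaller boxes. [folklore] -/
theorem PolLimitOnBox13.mono {γ γ' : ℝ} (h : PolLimitOnBox13 F θ γ) (hle : γ' ≤ γ) : PolLimitOnBox13 F θ γ' :=
  fun k v hv => h k v fun i => ⟨(hv i).1, (hv i).2.trans hle⟩

/-- The depth-`r` kernel of record IS the `(k+1+r)`-th member of the family whose `polLimit` is `limKernel13` (`rfl`). [cite: Balaban1987RG1, (1.21) p.264] -/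
theorem finKernel13_eq_polWindow (r k : ℕ) (hist : Fin (k + 1) → ℝ) (μ ν : Fin 4) (z : Fin 4 → ℤ) :
    finKernel13 F θ r k hist μ ν z =
      (letI := θ.instVβ₁; letI := θ.instVβ₂; letI := θ.instιβ
       (fun K => Node00.polWindow F K (k + 1)
          (Node00.mergedTermFamilyMatT F 2 (Node00.TβOfRecord₁₃ F 2) (Node00.chiβOfRecord₁₃ F 2 θ.toStage13Params) θ.εbg k hist K) θ.ρ8 θ.bV μ ν z)
        (k + 1 + r)) :=
  rfl

/-- **★ V-1 KERNEL: UNDER THE EXISTENCE CLAUSE, `finKernel13 → limKernel13` ENTRYWISE as the depth `r → ∞`** (`Node00.tendsto_polLimit` + the index shift `K = k+1+r → ∞`):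
`limKernel13` IS the printed (1.21) limit of the depth-`r` kernels of record, not a junk value. CONDITIONAL on `PolLimit13`. [cite: Balaban1987RG1, (1.21) p.264] -/
theorem tendsto_finKernel13_of_polLimit13 {k : ℕ} {hist : Fin (k + 1) → ℝ} (h : PolLimit13 F θ k hist) (μ ν : Fin 4) (z : Fin 4 → ℤ) :
    Tendsto (fun r => finKernel13 F θ r k hist μ ν z) atTop (𝓝 (limKernel13 F θ k hist μ ν z)) := by
  letI := θ.instVβ₁; letI := θ.instVβ₂; letI := θ.instιβ
  have hK := Node00.tendsto_polLimit F (k + 1)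
    (fun K => Node00.mergedTermFamilyMatT F 2 (Node00.TβOfRecord₁₃ F 2) (Node00.chiβOfRecord₁₃ F 2 θ.toStage13Params) θ.εbg k hist K) θ.ρ8 θ.bV h μ ν z
  have hr : Tendsto (fun r : ℕ => k + 1 + r) atTop atTop :=
    tendsto_atTop_atTop.2 fun b => ⟨b, fun a ha => ha.trans (Nat.le_add_left a (k + 1))⟩
  exact hK.comp hr

/-- **★ V-1 KERNEL, MOMENTS: at every FIXED window radius `R`, the truncated second moments of the depth-`r` kernels converge to those of the limiting kernel** (a finite sum of
convergent sequences).  So what TEXT B-i (VC) adds to the bare existence clause is displayed exactly: a k-UNIFORM RATE `τ₁` along the DIAGONAL `R = r` (window growing with the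
depth), which existence alone does not give. CONDITIONAL on `PolLimit13`. [cite: Balaban1987RG1, (1.21)–(1.22) p.264] -/
theorem tendsto_truncMoment_finKernel13_of_polLimit13 {k : ℕ} {hist : Fin (k + 1) → ℝ} (h : PolLimit13 F θ k hist) (R : ℕ) (μ ν : Fin 4) :
    Tendsto (fun r => truncMoment R (finKernel13 F θ r k hist) μ ν) atTop (𝓝 (truncMoment R (limKernel13 F θ k hist) μ ν)) := by
  simp only [truncMoment]
  exact tendsto_finsetSum _ fun z _ => ((tendsto_finKernel13_of_polLimit13 F θ h μ ν z).mul_const _).mul_const _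

/-- **`betaFin F θ r` — THE DEPTH-`r` FINITE-VOLUME β OF RECORD (ed.2, A3-CORRECTED)**: the radius-`r` TRUNCATED second moment `Σ_{z ∈ [−r,r]⁴} Π^{(k+1+r)}_{k+1,01}(z) z₀ z₁`
of the depth-`r` windowed kernel.  (Ed.1 took `B12Beta.secondMoment` = the `ℤ⁴`-`tsum` of the PERIODIC windowed kernel times `z₀z₁`, which is not summable unless
zero — junk value `0`; self-caught vacuity audit A3.  The window radius `r` is canonical and harmless: HYP B's `τ r` absorbs the tail.) A definition asserting nothing.
[cite: Balaban1987RG1, (1.21)–(1.22) p.264 and (5.42) p.297] -/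
def betaFin (r : ℕ) : HBeta := fun k hist => truncMoment r (finKernel13 F θ r k hist) 0 1

variable (hP : θ.Provisos₁₃SepCoPH F 2)

/-- **THE RECORD's β IS (1.22) OF THE LIMITING KERNEL, on the design box `]0, θ.γ]^{k+1}`** (def-T's `βfun_datumOfRecord₁₃SepCoPH`, def-B's `betaOfMerged_of_mem`;
`rfl` otherwise). [cite: Balaban1987RG1, (1.22) p.264] -/
theorem βfun_eq_secondMoment_limKernel13 {k : ℕ} {v : Fin (k + 1) → ℝ} (hv : v ∈ FlowStep.Box θ.γ k) :
    (Node00.datumOfRecord₁₃SepCoPH F 2 θ hP).βfun k v = B12Beta.secondMoment (limKernel13 F θ k v) 0 1 := by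
  rw [Node00.βfun_datumOfRecord₁₃SepCoPH]
  change Node00.betaOfMerged _ _ _ k v = _
  rw [Node00.betaOfMerged_of_mem _ _ _ hv]
  rfl

/-- The same on a `HistBox γ̄ k` with `γ̄ ≤ θ.γ`. [cite: Balaban1987RG1, (1.22) p.264] -/
theorem βfun_eq_secondMoment_limKernel13_of_histBox {γbar : ℝ} (hγ : γbar ≤ θ.γ) {k : ℕ} {v : Fin (k + 1) → ℝ} (hv : v ∈ HistBox γbar k) :
    (Node00.datumOfRecord₁₃SepCoPH F 2 θ hP).βfun k v = B12Beta.secondMoment (limKernel13 F θ k v) 0 1 :=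
  βfun_eq_secondMoment_limKernel13 F θ hP (FlowStep.box_mono hγ k ((FlowStep.histBox_eq_box γbar k) ▸ hv))

/-- **HYP A at the record** (OBLIGATION TEXT, size M+L): finite-volume Laplace for the PINNED `betaFin` — S-LAP (`LogMomentBound`, §3) + S-FMT (Thm-1-class format of the
depth-`r` fibre: `(n, c, M, ε)` from `(r, L, m)` and the format constants only). [cite: Balaban1987RG1, (2.12)–(2.14) p.268 and (1.3) p.260] -/
def FinLaplace13 (b0f : ℕ → ℕ → ℝ) (C : ℕ → ℝ) (γbar : ℝ) : Prop :=
  FinLaplace (betaFin F θ) b0f C γbar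

/-- **HYP B at the record** (OBLIGATION TEXT, size L, locality class, g²-FREE): the k-uniform thermodynamic rate of the truncated finite-volume moments to the
record's β on the box — supplied by (VC) + (UD) (`thermoRate13_of_volConv_unifDecay`). [cite: Balaban1987RG1, (1.21) p.264 and (5.10) p.293] -/
def ThermoRate13 (τ : ℕ → ℝ) (γbar : ℝ) : Prop :=
  ThermoRate (Node00.datumOfRecord₁₃SepCoPH F 2 θ hP).βfun (betaFin F θ) τ γbar

/-- **(VC) + (UD) at the record ⟹ HYP B at the record**, rate `τ₁ r + C·tail(δ₁, r)`. [cite: Balaban1987RG1, (1.21)–(1.22) p.264 and (5.10) p.293] -/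
theorem thermoRate13_of_volConv_unifDecay {τ₁ : ℕ → ℝ} {C δ₁ γbar : ℝ} (hγ : γbar ≤ θ.γ) (hδ : 0 < δ₁)
    (hVC : VolConv (finKernel13 F θ) (limKernel13 F θ) τ₁ γbar) (hUD : UnifDecay (limKernel13 F θ) C δ₁ γbar) :
    ThermoRate13 F θ hP (fun r => τ₁ r + C * tailMajorant δ₁ r) γbar :=
  thermoRate_of_volConv_unifDecay hδ hVC hUD fun _ _ hv => βfun_eq_secondMoment_limKernel13_of_histBox F θ hP hγ hv

/-- The two record-level hypotheses assemble the package (1ᴬᴸ at a tuple = HYP A + HYP B + (C)). [folklore] -/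
theorem pkg_of_record {b0f : ℕ → ℕ → ℝ} {C τ : ℕ → ℝ} {γbar : ℝ} (hγ : 0 < γbar) (hC : ∀ r, 0 ≤ C r)
    (hτ0 : Tendsto τ atTop (𝓝 0)) (hA : FinLaplace13 F θ b0f C γbar) (hB : ThermoRate13 F θ hP τ γbar) :
    ApproxLaplacePkg (Node00.datumOfRecord₁₃SepCoPH F 2 θ hP).βfun :=
  ⟨betaFin F θ, b0f, C, τ, γbar, hγ, hC, hτ0, hA, hB⟩

end Concrete

/-! ## §6 WHAT A LINE WOULD LOOK LIKE (displayed, NOT registered — an ideator registers nothing): FIVE texts, each strictly partial, none the crux reworded,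
three of them EXISTING currencies of the cell (2ᶜᴰ registered; (UD) = N17's `hU`; (C) = road (D5)), two NEW and about the PINNED objects (HYP A finite-volume
Laplace for `betaFin`; (VC) volume convergence of `finKernel13` to `limKernel13`) — and their kernel-checked composition to the crux decl BY NAME. -/

section Line

/-- TEXT A — **HYP A keyed** (NEW; size M+L; first lemma S-LAP `LogMomentBound`): at every tuple of the crux's prefix, history-free finite-volume one-loop numbers and
depth-wise Laplace constants with `FinLaplace (betaFin F θ) b0f C γ̄`.  OBLIGATION TEXT, never a fact. [cite: Balaban1987RG1, (2.12)–(2.14) p.268 and (1.3) p.260] -/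
def FinLaplace13K : Prop :=
  ∀ (F : T4Family) (θ : Node00.Stage13HParams F 2) (hP : θ.Provisos₁₃SepCoPH F 2), (θ.ZhUnity F 2 ∧ θ.SlotsNondegenerate₁₃ F 2) → θ.Admissible F 2 →
    B16.EndStatementBPrinted (Node00.datumOfRecord₁₃SepCoPH F 2 θ hP).C → Window13 F θ hP →
    ∃ (b0f : ℕ → ℕ → ℝ) (C : ℕ → ℝ) (γbar : ℝ), 0 < γbar ∧ (∀ r, 0 ≤ C r) ∧ FinLaplace13 F θ b0f C γbar

/-- TEXT B-i — **(VC) keyed** (NEW; size L; locality class, g²-free): at every tuple, a null `τ₁` and a box `]0, γ̄] ⊆ ]0, θ.γ]` with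
`VolConv (finKernel13 F θ) (limKernel13 F θ) τ₁ γ̄` — ed.4 (V-1): TOGETHER WITH the displayed (1.21) existence clause `PolLimitOnBox13 F θ γ̄` on that box, so that `limKernel13` IS the
printed limit there (existence + a k-uniform rate on the diagonal window; `tendsto_truncMoment_finKernel13_of_polLimit13` shows the fixed-window convergence existence alone gives).
OBLIGATION TEXT, never a fact. [cite: Balaban1987RG1, (1.21) p.264 and (1.7) p.261] -/
def VolConv13K : Prop :=
  ∀ (F : T4Family) (θ : Node00.Stage13HParams F 2) (hP : θ.Provisos₁₃SepCoPH F 2), (θ.ZhUnity F 2 ∧ θ.SlotsNondegenerate₁₃ F 2) → θ.Admissible F 2 →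
    B16.EndStatementBPrinted (Node00.datumOfRecord₁₃SepCoPH F 2 θ hP).C → Window13 F θ hP →
    ∃ (τ₁ : ℕ → ℝ) (γbar : ℝ), 0 < γbar ∧ γbar ≤ θ.γ ∧ Tendsto τ₁ atTop (𝓝 0) ∧ PolLimitOnBox13 F θ γbar ∧
      VolConv (finKernel13 F θ) (limKernel13 F θ) τ₁ γbar

/-- TEXT B-ii — **(UD) keyed** (EXISTING currency: N17's `hU` shape on SOME box; size L; shared with node N17 ∕ N22 ∕ the K0 (UD) road): at every tuple, constants
`C, δ₁ > 0` and a box with `UnifDecay (limKernel13 F θ) C δ₁ γ̄` — ed.4 (V-1): TOGETHER WITH the displayed (1.21) existence clause `PolLimitOnBox13 F θ γ̄`, so the text speaks of the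
printed limit kernel, not of a `limUnder` junk value.  OBLIGATION TEXT, never a fact; (5.10) is printed for Bałaban's kernels, instance 0∕1 in the tree.
[cite: Balaban1987RG1, (5.10) p.293 and (1.21) p.264] -/
def UnifDecay13K : Prop :=
  ∀ (F : T4Family) (θ : Node00.Stage13HParams F 2) (hP : θ.Provisos₁₃SepCoPH F 2), (θ.ZhUnity F 2 ∧ θ.SlotsNondegenerate₁₃ F 2) → θ.Admissible F 2 →
    B16.EndStatementBPrinted (Node00.datumOfRecord₁₃SepCoPH F 2 θ hP).C → Window13 F θ hP →
    ∃ (C δ₁ γbar : ℝ), 0 < δ₁ ∧ 0 < γbar ∧ γbar ≤ θ.γ ∧ PolLimitOnBox13 F θ γbar ∧ UnifDecay (limKernel13 F θ) C δ₁ γbar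

/-- TEXT C — **(C) keyed** (EXISTING currency, road (D5); shared with every (D4) supplier): run-wise survivor continuity at all small levels.  OBLIGATION TEXT.
[cite: Balaban1987RG1, Thm 3 p.264] -/
def SurvCont13K : Prop :=
  ∀ (F : T4Family) (θ : Node00.Stage13HParams F 2) (hP : θ.Provisos₁₃SepCoPH F 2), (θ.ZhUnity F 2 ∧ θ.SlotsNondegenerate₁₃ F 2) → θ.Admissible F 2 →
    B16.EndStatementBPrinted (Node00.datumOfRecord₁₃SepCoPH F 2 θ hP).C → Window13 F θ hP →
    ∃ γc : ℝ, 0 < γc ∧ ∀ γ : ℝ, 0 < γ → γ ≤ γc → SurvCont (Node00.datumOfRecord₁₃SepCoPH F 2 θ hP).βfun γ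

/-- `FinLaplace` restricts to smaller boxes. [folklore] -/
theorem FinLaplace.mono {βf : ℕ → HBeta} {b0f : ℕ → ℕ → ℝ} {C : ℕ → ℝ} {γ γ' : ℝ} (h : FinLaplace βf b0f C γ) (hle : γ' ≤ γ) : FinLaplace βf b0f C γ' :=
  fun r k v hv => h r k v fun i => ⟨(hv i).1, (hv i).2.trans hle⟩

/-- `VolConv` restricts to smaller boxes. [folklore] -/
theorem VolConv.mono {Pf : ℕ → (k : ℕ) → (Fin (k + 1) → ℝ) → B12Beta.Kernel 4} {P : (k : ℕ) → (Fin (k + 1) → ℝ) → B12Beta.Kernel 4} {τ₁ : ℕ → ℝ}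
    {γ γ' : ℝ} (h : VolConv Pf P τ₁ γ) (hle : γ' ≤ γ) : VolConv Pf P τ₁ γ' :=
  fun r k v hv => h r k v fun i => ⟨(hv i).1, (hv i).2.trans hle⟩

/-- `UnifDecay` restricts to smaller boxes. [folklore] -/
theorem UnifDecay.mono {P : (k : ℕ) → (Fin (k + 1) → ℝ) → B12Beta.Kernel 4} {C δ₁ γ γ' : ℝ} (h : UnifDecay P C δ₁ γ) (hle : γ' ≤ γ) : UnifDecay P C δ₁ γ' :=
  fun k v hv => h k v fun i => ⟨(hv i).1, (hv i).2.trans hle⟩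

/-- **THE FOUR (D4)∕(C)-SIDE TEXTS ⟹ 1ᴬᴸ** (boxes intersected; HYP B assembled from (VC) + (UD) by `thermoRate13_of_volConv_unifDecay`). [folklore] -/
theorem approxLaplace13_of_line (hA : FinLaplace13K) (hVC : VolConv13K) (hUD : UnifDecay13K) (hC : SurvCont13K) : ApproxLaplace13 := by
  intro F θ hP hU hθ hB hwin
  obtain ⟨b0f, C, γA, hγA, hC0, hAA⟩ := hA F θ hP hU hθ hB hwin
  obtain ⟨τ₁, γB, hγB, hγBθ, hτ₁, -, hVV⟩ := hVC F θ hP hU hθ hB hwin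
  obtain ⟨Cd, δ₁, γD, hδ, hγD, hγDθ, -, hDD⟩ := hUD F θ hP hU hθ hB hwin
  obtain ⟨γc, hγc, hcont⟩ := hC F θ hP hU hθ hB hwin
  set γbar := min γA (min γB γD) with hγbar
  have hγ : 0 < γbar := lt_min hγA (lt_min hγB hγD)
  have hleA : γbar ≤ γA := min_le_left _ _
  have hleB : γbar ≤ γB := (min_le_right _ _).trans (min_le_left _ _)
  have hleD : γbar ≤ γD := (min_le_right _ _).trans (min_le_right _ _)
  have hB13 : ThermoRate13 F θ hP (fun r => τ₁ r + Cd * tailMajorant δ₁ r) γbar :=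
    thermoRate13_of_volConv_unifDecay F θ hP (hleB.trans hγBθ) hδ (hVV.mono hleB) (hDD.mono hleD)
  exact ⟨pkg_of_record F θ hP hγ hC0 (tendsto_rate_of_volConv_unifDecay Cd δ₁ hτ₁) (hAA.mono hleA) hB13, γc, hγc, hcont⟩

open Summit.QuantumFields.YangMills.Theorems.BalabanUVNodesK2RunRowsSandwich (EndpointGivenBR13SepCoPH_of_cornerDriftK_cornerRunConstRemainderK) in
/-- **★★★ THE LINE, END TO END, BY NAME**: v7c's registered 2ᶜᴰ + TEXT A (HYP A, pinned) + TEXT B-i ((VC), pinned) + TEXT B-ii ((UD), N17's currency) + TEXT C ((C)) ⟹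
the crux decl `…BalabanUVNodes.EndpointGivenBR13SepCoPH`, through an4's (5d) socket.  CONDITIONAL on the five displayed texts; nothing of Bałaban asserted; K2⁷ OPEN;
[I] Thm 2 ∕ (0.31) p.259 UNPROVED IN PRINT; R4 = the conditional finite-𝕋⁴ rung only; no continuum ∕ OS ∕ mass-gap claim.
[cite: Balaban1987RG1, Thm 2 p.259 (first sentence), Thm 3 p.264, (1.21)–(1.22) p.264, (2.12)–(2.14) p.268 and (5.10) p.293] -/
theorem EndpointGivenBR13SepCoPH_of_line (h2CD : CornerDriftPos) (hA : FinLaplace13K) (hVC : VolConv13K) (hUD : UnifDecay13K) (hC : SurvCont13K) :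
    Summit.QuantumFields.YangMills.Theses.BalabanUVNodes.EndpointGivenBR13SepCoPH :=
  EndpointGivenBR13SepCoPH_of_cornerDriftK_cornerRunConstRemainderK h2CD
    (cornerRunConstRemainderK_of_approxLaplace13 (approxLaplace13_of_line hA hVC hUD hC))

/-- **★★★ THE SAME LINE WITH 2ᶜᴰ UNDER ITS TREE NAME** (ed.3b): `K2V7Defs.CornerDriftPos` (= registered `stub_cornerDriftPos13`'s type by `cornerDriftPos_iff_inline`) + the four
displayed texts ⟹ the crux decl BY NAME.  CONDITIONAL; registers nothing; K2⁷ NOT closed. [folklore] -/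
theorem EndpointGivenBR13SepCoPH_of_line_treeNamed
    (h2CD : Summit.QuantumFields.YangMills.Theorems.BalabanUVNodesK2V7Defs.CornerDriftPos)
    (hA : FinLaplace13K) (hVC : VolConv13K) (hUD : UnifDecay13K) (hC : SurvCont13K) :
    Summit.QuantumFields.YangMills.Theses.BalabanUVNodes.EndpointGivenBR13SepCoPH :=
  EndpointGivenBR13SepCoPH_of_line (cornerDriftPos_iff_tree.2 h2CD) hA hVC hUD hC

end Line

/-! ## §6b (ed.4 — IDEA-4 g13 nit n2 ADOPTED) TEXT C SHRINKS ON THIS LINE: (VC) + (UD) + EVENTUAL FINITE-VOLUME CONTINUITY ⟹ run-wise (C).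
The k-uniform inputs stay (VC) + (UD); the sign input stays 2ᶜᴰ ∕ (D1); what is left of (C) is a FINITE-DIMENSIONAL regularity letter about the pinned `betaFin`. -/

section FinCont

variable {β : HBeta} {βf : ℕ → HBeta} {τ : ℕ → ℝ} {γbar : ℝ}

/-- **EVENTUAL FINITE-VOLUME CONTINUITY** (IDEA-4 g13's `Idea4g13.FinContEv`, body VERBATIM; moment currency): for each scale `k`, the depth-`r` finite-volume β `βf r k` is
continuous on the box `]0, γ̄]^{k+1}` for all large `r`.  INTENDED INSTANCE `βf := betaFin F θ` — finitely many `polWindow` entries of ONE functional on ONE finite torus per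
`(r, k)`, times a finite window sum: finite-dimensional regularity in the couplings, NO k-uniformity, NO sign.  HYPOTHESIS SHAPE, never a fact.
[cite: Balaban1987RG1, (1.18)–(1.22) pp.263–264] -/
def FinContEv (βf : ℕ → HBeta) (γbar : ℝ) : Prop :=
  ∀ k : ℕ, ∀ᶠ r in atTop, ContinuousOn (βf r k) (HistBox γbar k)

/-- `FinContEv` restricts to smaller boxes. [folklore] -/
theorem FinContEv.mono {γ γ' : ℝ} (h : FinContEv βf γ) (hle : γ' ≤ γ) : FinContEv βf γ' :=
  fun k => (h k).mono fun _ hr => hr.mono fun _ hv i => ⟨(hv i).1, (hv i).2.trans hle⟩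

/-- **(IDEA-4 g13 T2′ — proof VERBATIM, attributed) HYP B with a NULL rate + eventual finite-volume continuity ⟹ (C) ON THE BOXES**: a uniform limit of eventually-continuous
functions is continuous (`Metric.tendstoUniformlyOn_iff`, `TendstoUniformlyOn.continuousOn`), box by box (`FlowStep.histBox_eq_box`).  Restated in this namespace only because crux
workfiles do not import one another; the lemma is IDEA-4's (`Cruxes/EndpointGivenBR13SepCoPH/Idea4g13ContFromThermoRate.lean`). [folklore] -/
theorem betaContH_of_thermoRate_finContEv (hT : ThermoRate β βf τ γbar) (hτ : Tendsto τ atTop (𝓝 0)) (hC : FinContEv βf γbar) :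
    BetaContH γbar β := by
  intro k
  have hU : TendstoUniformlyOn (fun r => βf r k) (β k) atTop (HistBox γbar k) := by
    rw [Metric.tendstoUniformlyOn_iff]
    intro ε hε
    filter_upwards [hτ.eventually (gt_mem_nhds hε)] with r hr v hv
    rw [Real.dist_eq, abs_sub_comm]
    exact (hT r k v hv).trans_lt hr
  rw [← histBox_eq_box]
  exact hU.continuousOn (hC k).frequently

/-- … hence RUN-WISE (C) at every level `0 < γ₀ ≤ γ̄` (`K2NamedJetsRunRemAt.SurvCont.of_betaContH` BY NAME, `FlowStep.box_mono`). [folklore] -/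
theorem survCont_of_thermoRate_finContEv (hT : ThermoRate β βf τ γbar) (hτ : Tendsto τ atTop (𝓝 0)) (hC : FinContEv βf γbar)
    {γ₀ : ℝ} (hγ₀ : 0 < γ₀) (hle : γ₀ ≤ γbar) : SurvCont β γ₀ :=
  Summit.QuantumFields.YangMills.Theorems.BalabanUVNodesK2NamedJetsRunRemAt.SurvCont.of_betaContH hγ₀ fun k =>
    (betaContH_of_thermoRate_finContEv hT hτ hC k).mono (FlowStep.box_mono hle k)

/-- TEXT FC — **EVENTUAL FINITE-VOLUME CONTINUITY OF `betaFin`, keyed** (ed.4; REPLACES TEXT C as the displayed (C)-side text of this line; size S–M, finite-dimensional): at every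
tuple of the crux's prefix, a box `]0, γ̄]` with `FinContEv (betaFin F θ) γ̄`.  OBLIGATION TEXT, never a fact (the SITEWISE analogue for the record's objects is N26's
`n26lit_betaOfTerms_of_finiteVolume`, (i)-half; the sitewise road to (C) is `Literature/…/Beta/BetaContinuityVolume`). [cite: Balaban1987RG1, (1.18)–(1.22) pp.263–264] -/
def FinCont13K : Prop :=
  ∀ (F : T4Family) (θ : Node00.Stage13HParams F 2) (hP : θ.Provisos₁₃SepCoPH F 2), (θ.ZhUnity F 2 ∧ θ.SlotsNondegenerate₁₃ F 2) → θ.Admissible F 2 →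
    B16.EndStatementBPrinted (Node00.datumOfRecord₁₃SepCoPH F 2 θ hP).C → Window13 F θ hP →
    ∃ γbar : ℝ, 0 < γbar ∧ FinContEv (betaFin F θ) γbar

/-- **★ n2 IN THE KERNEL: TEXT B-i + TEXT B-ii + TEXT FC ⟹ TEXT C** (`SurvCont13K`): per tuple, (VC) + (UD) give `ThermoRate13` with the NULL rate `τ₁ r + C·tail(δ₁, r)`
(`thermoRate13_of_volConv_unifDecay`, `tendsto_rate_of_volConv_unifDecay`) on the intersected box, and `survCont_of_thermoRate_finContEv` gives run-wise (C) at every smaller level.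
CONDITIONAL on the three displayed texts; nothing of Bałaban asserted. [cite: Balaban1987RG1, (1.21)–(1.22) p.264, (5.10) p.293 and §1 pp.263–264] -/
theorem survCont13K_of_volConv_unifDecay_finCont (hVC : VolConv13K) (hUD : UnifDecay13K) (hFC : FinCont13K) : SurvCont13K := by
  intro F θ hP hU hθ hB hwin
  obtain ⟨τ₁, γB, hγB, hγBθ, hτ₁, -, hVV⟩ := hVC F θ hP hU hθ hB hwin
  obtain ⟨Cd, δ₁, γD, hδ, hγD, hγDθ, -, hDD⟩ := hUD F θ hP hU hθ hB hwin
  obtain ⟨γE, hγE, hEE⟩ := hFC F θ hP hU hθ hB hwin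
  set γbar := min γB (min γD γE) with hγbar
  have hγ : 0 < γbar := lt_min hγB (lt_min hγD hγE)
  have hleB : γbar ≤ γB := min_le_left _ _
  have hleD : γbar ≤ γD := (min_le_right _ _).trans (min_le_left _ _)
  have hleE : γbar ≤ γE := (min_le_right _ _).trans (min_le_right _ _)
  have hT : ThermoRate13 F θ hP (fun r => τ₁ r + Cd * tailMajorant δ₁ r) γbar :=
    thermoRate13_of_volConv_unifDecay F θ hP (hleB.trans hγBθ) hδ (hVV.mono hleB) (hDD.mono hleD)
  exact ⟨γbar, hγ, fun γ hγ0 hγle =>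
    survCont_of_thermoRate_finContEv hT (tendsto_rate_of_volConv_unifDecay Cd δ₁ hτ₁) (hEE.mono hleE) hγ0 hγle⟩

/-- **★★★ THE LINE, EDITION 4, END TO END BY NAME**: v7c's registered 2ᶜᴰ + TEXT A (HYP A, pinned) + TEXT B-i ((VC) WITH the (1.21) existence clause, pinned) + TEXT B-ii ((UD) WITH the
existence clause) + TEXT FC (eventual finite-volume continuity, pinned) ⟹ the K2⁷ decl `…BalabanUVNodes.EndpointGivenBR13SepCoPH` (now `aside`; kept as the supplier road it is).
CONDITIONAL on the five displayed texts; nothing of Bałaban asserted; [I] Thm 2 ∕ (0.31) p.259 UNPROVED IN PRINT; R4 = the conditional finite-𝕋⁴ rung only; no continuum ∕ OS ∕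
mass-gap claim. [cite: Balaban1987RG1, Thm 2 p.259 (first sentence), Thm 3 p.264, (1.21)–(1.22) p.264, (2.12)–(2.14) p.268 and (5.10) p.293] -/
theorem EndpointGivenBR13SepCoPH_of_line4 (h2CD : CornerDriftPos) (hA : FinLaplace13K) (hVC : VolConv13K) (hUD : UnifDecay13K) (hFC : FinCont13K) :
    Summit.QuantumFields.YangMills.Theses.BalabanUVNodes.EndpointGivenBR13SepCoPH :=
  EndpointGivenBR13SepCoPH_of_line h2CD hA hVC hUD (survCont13K_of_volConv_unifDecay_finCont hVC hUD hFC)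

end FinCont

/-! ## §7 (ed.4, route rev 27) THE K1⁸ BEARING BY NAME: the line supplies the ROWS CONJUNCT `K1R8RowsDefs.RunRowsCont13 F θ` of the DECIDING crux
`…Theses.BalabanUVNodes.StabilityBRunRowsAtRecordR13SepCoPH` (stmt-QuantumFields-26907) — per tuple (the ∃-side atom K1⁸ consumes at its witness), K-keyed (the ∀θ supplier
programme `K1R8RowsDefs.RowsContAll`), and WITH K1⁷ the crux decl itself; row (iv)'s floor `M := 2A` PAID BY 2ᶜᴰ's DRIFT (an4's bridge), row (i) by the package's constant
remainder AT the drift slope, (C) as delivered ∕ from TEXT FC (§6b). -/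

section K1R8Bearing

open Summit.QuantumFields.YangMills.Theorems.BalabanUVNodesK2RunRowsContOfCorner
  (runRowsCont13Body_of_drift_runConstRemainder_survCont rowsContAllK_of_ownDrift_runConstRemainderK)
open Summit.QuantumFields.YangMills.Theorems.BalabanUVNodesK1R8RowsDefs
  (RunRowsCont13 RowsContAll rowsContAll_iff stabilityBRunRowsAtRecordR13SepCoPH_iff stabilityBRunRowsAtRecordR13SepCoPH_of_k17_rowsContAll
    endpointGivenBR13SepCoPH_of_rowsContAll)
open Summit.QuantumFields.YangMills.Theses.BalabanUVNodes (StabilityBAtRecordR13SepCoPH StabilityBRunRowsAtRecordR13SepCoPH)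

/-- **★ THE ∃-SIDE ATOM (what K1⁸ consumes AT ITS WITNESS)**: at ONE Stage-13 tuple `(θ, hP)`, 2ᶜᴰ's BODY there (an anchored, positively drifting corner sequence), the
approximant-Laplace PACKAGE for the datum's β there, and run-wise (C) at all small levels there ⟹ the rows conjunct `RunRowsCont13 F θ`: row (i) = the package's constant remainder
AT THE DRIFT SLOPE `s` (cap met with `le_rfl`; `b = b∞` by `ScaleAnchor.eq`) restricted to runs, row (iv) with floor `M := 2A` PAID BY THE DRIFT (an4's
`runRowsCont13Body_of_drift_runConstRemainder_survCont` BY NAME), (C) cut to the common level; `(datum).βfun = betaOfRecord₁₃` by `rfl`.  CONDITIONAL on the three hypotheses;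
instance 0∕1; K1⁸ NOT closed. [cite: Balaban1987RG1, Thm 3 p.264, (1.22) p.264, (2.12)–(2.14) p.268 and (5.10) p.293] -/
theorem runRowsCont13_of_cornerDriftAt_pkgAt_survContAt (F : T4Family) (θ : Node00.Stage13HParams F 2) (hP : θ.Provisos₁₃SepCoPH F 2)
    (h₁ : ∃ (b : ℕ → ℝ) (s A : ℝ), ScaleAnchor (Node00.datumOfRecord₁₃SepCoPH F 2 θ hP).βfun b ∧ 0 < s ∧ OneLoopDrift s A b)
    (hpkg : ApproxLaplacePkg (Node00.datumOfRecord₁₃SepCoPH F 2 θ hP).βfun)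
    (hC : ∃ γc : ℝ, 0 < γc ∧ ∀ γ : ℝ, 0 < γ → γ ≤ γc → SurvCont (Node00.datumOfRecord₁₃SepCoPH F 2 θ hP).βfun γ) :
    RunRowsCont13 F θ := by
  obtain ⟨b, s, A, hanch, hs, hdrift⟩ := h₁
  obtain ⟨γc, hγc, hcont⟩ := hC
  obtain ⟨bInf, hanch', hrem⟩ := anchor_and_constRemainder_of_pkg hpkg
  have hbb : b = bInf := hanch.eq hanch'
  subst hbb
  obtain ⟨γ₀, hγ₀, hrem₀⟩ := hrem s hs
  exact runRowsCont13Body_of_drift_runConstRemainder_survCont F θ hP hdrift (lt_min hγ₀ hγc) le_rfl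
    (runConstRemainder_of_constRemainder (hrem₀.mono (min_le_left _ _))) (hcont _ (lt_min hγ₀ hγc) (min_le_right _ _))

/-- **★★ K-KEYED: {2ᶜᴰ, 1ᴬᴸ} ⟹ THE ∀θ ROWS PROGRAMME `RowsContAll`** — through an4's weak K-text `rowsContAllK_of_ownDrift_runConstRemainderK` BY NAME (this line is one more SUPPLIER of
that text: the drift from 2ᶜᴰ; window, radius `r := s`, run-wise remainder and (C) from 1ᴬᴸ by `cornerRunConstRemainderK_of_approxLaplace13`).  CONDITIONAL; nothing registered.
[cite: Balaban1987RG1, Thm 3 p.264, (2.12)–(2.14) p.268 and (5.10) p.293] -/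
theorem rowsContAll_of_cornerDrift_approxLaplace13 (h₁ : CornerDriftPos) (h₂ : ApproxLaplace13) : RowsContAll :=
  rowsContAll_iff.2 <|
    rowsContAllK_of_ownDrift_runConstRemainderK fun F θ hP hU hθ hB hwin => by
      obtain ⟨b, s, A, hanch, hs, hdrift⟩ := h₁ F θ hP hU hθ hB hwin
      obtain ⟨γ₀, r, hγ₀, hr, hrem, hsc⟩ := cornerRunConstRemainderK_of_approxLaplace13 h₂ F θ hP hU hθ hB hwin b s A hanch hs hdrift
      exact ⟨b, s, A, γ₀, r, hdrift, hγ₀, hr, hrem, hsc⟩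

/-- **THE FOUR ed.3 TEXTS + 2ᶜᴰ ⟹ `RowsContAll`** (TEXT C as delivered). CONDITIONAL. [folklore] -/
theorem rowsContAll_of_line (h2CD : CornerDriftPos) (hA : FinLaplace13K) (hVC : VolConv13K) (hUD : UnifDecay13K) (hC : SurvCont13K) : RowsContAll :=
  rowsContAll_of_cornerDrift_approxLaplace13 h2CD (approxLaplace13_of_line hA hVC hUD hC)

/-- **THE ed.4 LINE ⟹ `RowsContAll`** (TEXT FC in place of TEXT C, §6b). CONDITIONAL. [folklore] -/
theorem rowsContAll_of_line4 (h2CD : CornerDriftPos) (hA : FinLaplace13K) (hVC : VolConv13K) (hUD : UnifDecay13K) (hFC : FinCont13K) : RowsContAll :=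
  rowsContAll_of_line h2CD hA hVC hUD (survCont13K_of_volConv_unifDecay_finCont hVC hUD hFC)

/-- **★★★ THE DECIDING CRUX K1⁸ BY NAME FROM K1⁷ + THE ed.4 LINE**: `StabilityBAtRecordR13SepCoPH` (K1⁷, stmt-QuantumFields-20542, `aside`) + v7c's 2ᶜᴰ + TEXT A + TEXT B-i + TEXT B-ii
+ TEXT FC ⟹ `…Theses.BalabanUVNodes.StabilityBRunRowsAtRecordR13SepCoPH` (stmt-QuantumFields-26907) — DEF-1's `stabilityBRunRowsAtRecordR13SepCoPH_of_k17_rowsContAll` BY NAME (the rows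
read at K1⁷'s own witness).  CONDITIONAL on the six displayed texts; K1⁷ ∕ K1⁸ NOT closed; nothing of Bałaban asserted; [I] Thm 2 ∕ (0.31) p.259 UNPROVED IN PRINT; R4 = the conditional
finite-𝕋⁴ rung `BalabanLadder.UV` only — NOT continuum ∕ OS ∕ mass gap; the Clay problem is NOT proved by any of this.
[cite: Balaban1989LargeFieldII, Thm 1 p.355; Balaban1987RG1, Thm 3 p.264, (1.21)–(1.22) p.264, (2.12)–(2.14) p.268, (5.10) p.293 and §1 pp.263–264] -/
theorem stabilityBRunRowsAtRecordR13SepCoPH_of_k17_line4 (h1 : StabilityBAtRecordR13SepCoPH) (h2CD : CornerDriftPos) (hA : FinLaplace13K) (hVC : VolConv13K)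
    (hUD : UnifDecay13K) (hFC : FinCont13K) : StabilityBRunRowsAtRecordR13SepCoPH :=
  stabilityBRunRowsAtRecordR13SepCoPH_of_k17_rowsContAll h1 (rowsContAll_of_line4 h2CD hA hVC hUD hFC)

/-- The same with 2ᶜᴰ under its TREE NAME `K2V7Defs.CornerDriftPos` (= the registered `stub_cornerDriftPos13`'s type, `cornerDriftPos_iff_inline`). CONDITIONAL. [folklore] -/
theorem stabilityBRunRowsAtRecordR13SepCoPH_of_k17_line4_treeNamed (h1 : StabilityBAtRecordR13SepCoPH)
    (h2CD : Summit.QuantumFields.YangMills.Theorems.BalabanUVNodesK2V7Defs.CornerDriftPos)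
    (hA : FinLaplace13K) (hVC : VolConv13K) (hUD : UnifDecay13K) (hFC : FinCont13K) : StabilityBRunRowsAtRecordR13SepCoPH :=
  stabilityBRunRowsAtRecordR13SepCoPH_of_k17_line4 h1 (cornerDriftPos_iff_tree.2 h2CD) hA hVC hUD hFC

/-- CONSISTENCY: through the programme the ed.4 line still gives the `aside` decl K2⁷ (DEF-1's `endpointGivenBR13SepCoPH_of_rowsContAll`), agreeing with §6b's direct road
`EndpointGivenBR13SepCoPH_of_line4`. CONDITIONAL. [folklore] -/
theorem EndpointGivenBR13SepCoPH_of_line4_viaRows (h2CD : CornerDriftPos) (hA : FinLaplace13K) (hVC : VolConv13K) (hUD : UnifDecay13K) (hFC : FinCont13K) :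
    Summit.QuantumFields.YangMills.Theses.BalabanUVNodes.EndpointGivenBR13SepCoPH :=
  endpointGivenBR13SepCoPH_of_rowsContAll (rowsContAll_of_line4 h2CD hA hVC hUD hFC)

/-- **★ THE HONEST ∃-SIDE PRICE (V-2)**: K1⁸ consumes the three atoms AT ONE WITNESS ONLY — if SOME unity Stage-13 tuple with provisos carries admissibility, (B) and the window
(= K1⁷'s conclusion there) AND, THERE, 2ᶜᴰ's body, the approximant-Laplace package and small-level (C), then K1⁸ (`stabilityBRunRowsAtRecordR13SepCoPH_iff` + the ∃-side atom).
No ∀θ text is consumed.  CONDITIONAL; K1⁸ NOT closed. [cite: Balaban1989LargeFieldII, Thm 1 p.355; Balaban1987RG1, Thm 3 p.264, (2.12)–(2.14) p.268 and (5.10) p.293] -/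
theorem stabilityBRunRowsAtRecordR13SepCoPH_of_witnessAtoms
    (h : ∀ F : T4Family, Summit.QuantumFields.YangMills.Theorems.K1V6Defs.Inhabited13 F →
      ∃ (θ : Node00.Stage13HParams F 2) (hP : θ.Provisos₁₃SepCoPH F 2),
        (θ.ZhUnity F 2 ∧ θ.SlotsNondegenerate₁₃ F 2) ∧ θ.Admissible F 2 ∧ B16.EndStatementBPrinted (Node00.datumOfRecord₁₃SepCoPH F 2 θ hP).C ∧
        Summit.QuantumFields.YangMills.Theorems.K1V6Defs.Window (Node00.datumOfRecord₁₃SepCoPH F 2 θ hP) ∧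
        (∃ (b : ℕ → ℝ) (s A : ℝ), ScaleAnchor (Node00.datumOfRecord₁₃SepCoPH F 2 θ hP).βfun b ∧ 0 < s ∧ OneLoopDrift s A b) ∧
        ApproxLaplacePkg (Node00.datumOfRecord₁₃SepCoPH F 2 θ hP).βfun ∧
        (∃ γc : ℝ, 0 < γc ∧ ∀ γ : ℝ, 0 < γ → γ ≤ γc → SurvCont (Node00.datumOfRecord₁₃SepCoPH F 2 θ hP).βfun γ)) :
    StabilityBRunRowsAtRecordR13SepCoPH :=
  stabilityBRunRowsAtRecordR13SepCoPH_iff.2 fun F hF => by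
    obtain ⟨θ, hP, hU, hθ, hB, hwin, h₁, hpkg, hC⟩ := h F hF
    exact ⟨θ, hP, hU, hθ, hB, hwin, runRowsCont13_of_cornerDriftAt_pkgAt_survContAt F θ hP h₁ hpkg hC⟩

end K1R8Bearing

end Summit.QuantumFields.YangMills.Cruxes.EndpointGivenBR13SepCoPH.ApproximantLaplace
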